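import Literature.MathematicalPhysics.QuantumLattice.HubbardWindowCertificateD4
import Literature.MathematicalPhysics.QuantumLattice.HubbardHalfFilledGroundStateTorus
import Literature.MathematicalPhysics.QuantumLattice.HartreeFockSDWThermodynamicLimit
import Literature.MathematicalPhysics.QuantumLattice.InfVolFermionStateCompactness
import Literature.MathematicalPhysics.QuantumLattice.InfVolFermionStateDensity
import Literature.MathematicalPhysics.QuantumLattice.HubbardDoubleOccupancyBounds
import HarnessLib

/-!
# Bootstrap certificates with an ENERGY CONSTRAINT: certified bounds on ground-state CORRELATORS
# of the Hubbard model (finite tori, and torus-limit ground states of `ℤ²`)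

Family `hubbard` (topic `MathematicalPhysics/QuantumLattice`). Wang–Surace–Frérot–Legat–Renou–
Magron–Acín, *Certifying ground-state properties of many-body systems*, PRX 14 (2024) 031006, §III:
a moment / sum-of-squares relaxation of the ground-state problem bounds an arbitrary observable `O`
in the ground state once the ENERGY CONSTRAINT `⟨E_up·1 − H⟩ ≥ 0` (with `E_up` a variational —
here: certified — upper bound on the ground-state energy) is added to the relaxation, because the
ground state is feasible for it; X. Han, arXiv:2006.06002 (2020) §2–3 for the translation-invariant
(thermodynamic-limit) relaxation with stationarity `⟨[H,O]⟩ = 0`, symmetry and density constraints.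
In certificate form (bundle papers/HubbardSuperconductivity/manybody-bootstrap/, format `certsdp/1`
§6–§7: objective `λ·V`, inequality hypothesis `ω(h₀) ≤ u` with a multiplier `κ ≥ 0`) the identity is

  `X − c·1 − Σᵢ μᵢ (Dᵢ − νᵢ·1) − κ (u·1 − E) = Σ Λₐᵦ Oₐᴴ O_b + (null terms) + (Σₘ dₘ (Vₘᴴ − Vₘ) + Σₖ aₖ Mₖ)`

with `X` the (local) objective, `E` a local energy whose translates sum to the Hamiltonian, `Dᵢ`
local densities. Evaluated in the tracial ground state `ω_P` of a sector of a finite torus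
(`Matrix.re_projState_ge_of_local_certificate`, SymmetricLocalCertificate) it gives

  `c − Σₖ ‖aₖ‖ + Σᵢ μᵢ (gᵢ/L^d − νᵢ) + κ (u − E₀/L^d) ≤ Re ω_P(X)`

(`hubbardTorus_re_projState_ge_of_local_certificate_ineq`): a certified bound on the ground-state
expectation of `X`, with the explicit, signed energy slack `κ (u − E₀/L^d)` (nonnegative as soon
as `E₀/L^d ≤ u`). The window form for the square lattice with affine `D₄` reductions
(`re_projState_ge_of_window_certificate_d4_ineq`) pulls ONE identity in the CAR algebra of a finite
window back into every large torus, exactly as `groundEnergyAt_div_ge_of_window_certificate_d4`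
(HubbardWindowCertificateD4) does for the energy. At half filling on even tori the tracial sector
ground state is THE ground state (Lieb 1989, `LiebHalfFilled.hubbardTorus_exists_unit_groundState`),
so the bound holds for every normalised ground-state vector
(`groundState_re_expect_ge_of_window_certificate_d4_ineq`), and passing to the limit along even
tori it holds for every TORUS-LIMIT infinite-volume ground state `ω` of `ℤ²`
(`InfVolFermionState.IsTorusLimitOf`): `c − Σₖ ‖aₖ‖ ≤ Re ω(X)` as soon as the thermodynamic-limit
energy density satisfies `energyDensity2D t U 1 ≤ u`
(`InfVolFermionState.IsTorusLimitOf.re_expect_ge_of_window_certificate_d4_ineq`, through the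
translation-averaged finite form `groundState_re_torusAvgExpectAt_ge_of_window_certificate_d4_ineq`).
Such torus-limit ground states exist (`LiebHalfFilled.exists_isTorusLimitOf_groundState`, from
weak-⋆ compactness `InfVolFermionState.exists_isTorusLimitOf_subseq`), so the statement is not
vacuous. The certified local double occupancy of such a state is tied to the thermodynamic energy
density: `e(t,U',n) − e(t,U,n) ≤ (U' − U)·Re ω(n_{0↑}n_{0↓})` for all `U' ≥ 0`
(`InfVolFermionState.IsTorusLimitOf.energyDensity2D_sub_le_mul_re_expect_docc`, the torus-limit
form of `DoubleOccupancy.energyDensity2D_sub_le_mul_of_tendsto`; `torusAvgExpect_docc`); consequently every certified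
docc row is also a family of certified ENERGY upper bounds at the other couplings,
`e(t,U',1) ≤ u + (U' − U)·hi` (`U' ≥ U`) and `e(t,U',1) ≤ u − (U − U')·lo` (`0 ≤ U' ≤ U`)
(`ThermodynamicLimit.energyDensity2D_le_of_forall_isTorusLimitOf_docc_le`, `…_le_docc`, stated with
the bound hypotheses in the shape of the bundle's typed correlator rows). A certificate issued for one certified energy bound `u` is a certificate for any weaker
`u' ≥ u` with the constant lowered by `κ (u' − u)` (`certificate_ineq_reparam`). Not covered here: the
one-dimensional (affine-reduction) window form and fillings `n ≠ 1` (where the tracial sector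
ground state of `re_projState_ge_of_window_certificate_d4_ineq` is the statement). Everything is
PROVED; no definition, no named fact.

## References
* J. Wang, J. Surace, I. Frérot, B. Legat, M.-O. Renou, V. Magron, A. Acín, *Certifying ground-state
  properties of many-body systems*, Phys. Rev. X 14 (2024) 031006, §III (energy constraint
  `⟨E_up − H⟩ ≥ 0` in the relaxation of `⟨O⟩`). [cite: WangEtAl2024, §III]
* X. Han, *Quantum many-body bootstrap*, arXiv:2006.06002 (2020), §2 eq. (2)–(3), §3.
  [cite: Han2020Bootstrap, §3]
* E. H. Lieb, PRL 62 (1989) 1201, Theorem 2 (unique half-filled ground state). [cite: LiebPRL1989, Theorem 2]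
* O. Bratteli, D. W. Robinson, *Operator Algebras and Quantum Statistical Mechanics II*, 2nd ed.,
  §6.2.4 (periodic states, mean values per site). [cite: BratteliRobinsonII1997, §6.2.4]
* T. Koma, H. Tasaki, J. Stat. Phys. 76 (1994) 745, §1 (order parameters as one-sided derivatives
  of the ground-state energy). [cite: KomaTasaki1994, §1]
-/

noncomputable section

namespace Literature.MathematicalPhysics.QuantumLattice

open Matrix Finset HubbardWave0 Literature.Probability.LatticeModels
open Literature.MathematicalPhysics.QuantumManyBody.StateRelaxation
open scoped ComplexOrder BigOperators

/-! ### The certificate with an energy constraint on a torus -/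

section Torus

variable {d L : ℕ} [NeZero L]

/-- (Local to this file, as in `HubbardTorusLocalCertificate`.) [folklore] -/
local instance (priority := high) instDecidableEqFermionTorusCorr : DecidableEq (FermionTorus d L) :=
  LinearOrder.toDecidableEq

/-- **The translation average of an observable in the tracial sector ground state**:
`ω_P(Σ_v U_v X U_vᴴ) = L^d · ω_P(X)` for the translation unitaries `U_v = fockTranslate v` of the
torus and the tracial ground state `ω_P` of the sector `(2n, S^z = 0)` of `hubbardTorus d L t U`.
[cite: BratteliRobinsonII1997, §6.2.4] -/
theorem hubbardTorus_projState_sum_conj_fockTranslate (t U : ℝ) (nh : ℕ)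
    (X : Matrix (Finset (Orb (FermionTorus d L))) (Finset (Orb (FermionTorus d L))) ℂ) :
    ((hubbardTorus d L t U).sectorGroundProj (szSector (2 * nh) 0)).projState
        (∑ v : TorusSite d L, (fockTranslate v).val * X * (fockTranslate v).valᴴ) =
      ((L ^ d : ℕ) : ℂ) * ((hubbardTorus d L t U).sectorGroundProj (szSector (2 * nh) 0)).projState X := by
  set A := hubbardTorus d L t U with hAdef
  set K : Submodule ℂ (Fock (Orb (FermionTorus d L))) := szSector (2 * nh) 0 with hKdef
  have hA : A.IsHermitian := hubbardTorus_isHermitian (hamiltonian_isHermitian_and_commute_holds _) t U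
  have hPT : ∀ v : TorusSite d L, A.sectorGroundProj K * (fockTranslate v).val =
      (fockTranslate v).val * A.sectorGroundProj K := fun v =>
    sectorGroundProj_commute hA K (fockTranslate_mul_hubbardTorus v t U)
      (fun ψ hψ => fockTranslate_mulVec_mem_szSector v hψ)
      (fun ψ hψ => fockTranslate_conjTranspose_mulVec_mem_szSector v hψ)
  rw [projState_sum_conj (fun v => (fockTranslate v).val) hPT fockTranslate_conjTranspose_mul_self X,
    card_torusSite]

/-- **Certificate with an energy constraint ⇒ ground-state expectation of a local observable
(Hubbard torus).** Let `H = hubbardTorus d L t U`, `K = szSector (2n) 0` (`n ≤ L^d`), `ω_P` the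
tracial ground state of `K` (`P = H.sectorGroundProj K`) and `U_v = fockTranslate v`. Suppose the
translates of a local energy `E` sum to `H`, `Σ_v U_v E U_vᴴ = H`, the translates of constraint
observables `Dᵢ` sum to Hermitian `Gᵢ` acting as the real scalars `gᵢ` on `K`, and the torus algebra
carries, for an objective `X` and reals `κ, u`, the identity
`X − c·1 − Σᵢ μᵢ (Dᵢ − νᵢ·1) − κ (u·1 − E) = Σ Λₐᵦ Oₐᴴ O_b + (Σₖ (H Xₖ − Xₖ H) + Σₗ (Uₗ Yₗ Uₗᴴ − Yₗ)
  + Σᵣ (Zᵣ (Qᵣ − qᵣ) + (Qᵣ − qᵣ) Z'ᵣ) + Σⱼ (Cⱼ Wⱼ − Wⱼ Cⱼ)) + (Σₘ dₘ • (Vₘᴴ − Vₘ) + Σₖ aₖ • Mₖ)`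
with `Λ ⪰ 0`, symmetries `Uₗ` / charges `Cⱼ` commuting with `H` and (with their adjoints) preserving
`K`, `Uₗᴴ Uₗ = 1`, Hermitian `Qᵣ = qᵣ` on `K`, real `dₘ`, contractions `Mₖ`. Then
`c − Σₖ ‖aₖ‖ + Σᵢ μᵢ (gᵢ/L^d − νᵢ) + κ (u − groundEnergyAt (fermionTorusGraph d L) t U (2n) / L^d) ≤ Re ω_P(X)`.
(No sign condition on `κ` is needed for this identity-level statement; with `κ ≥ 0` and
`E₀(2n)/L^d ≤ u` the slack term is nonnegative, `…_of_energy_le`.) Wang et al. 2024 §III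
(energy constraint in the relaxation), Han 2020 §2–3 (translation-invariant relaxation).
[cite: WangEtAl2024, §III] -/
theorem hubbardTorus_re_projState_ge_of_local_certificate_ineq (t U : ℝ) {nh : ℕ}
    (hn : nh ≤ Fintype.card (FermionTorus d L))
    (X E : Matrix (Finset (Orb (FermionTorus d L))) (Finset (Orb (FermionTorus d L))) ℂ)
    (hE : ∑ v : TorusSite d L, (fockTranslate v).val * E * (fockTranslate v).valᴴ =
      hubbardTorus d L t U) (κ u : ℝ)
    {δ' : Type*} (dens : Finset δ') (μ ν g : δ' → ℝ)
    (D G : δ' → Matrix (Finset (Orb (FermionTorus d L))) (Finset (Orb (FermionTorus d L))) ℂ)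
    (hD : ∀ i ∈ dens, ∑ v : TorusSite d L, (fockTranslate v).val * D i * (fockTranslate v).valᴴ = G i)
    (hGh : ∀ i ∈ dens, (G i).IsHermitian)
    (hG : ∀ i ∈ dens, ∀ ψ ∈ (szSector (2 * nh) 0 : Submodule ℂ (Fock (Orb (FermionTorus d L)))),
      G i *ᵥ ψ = ((g i : ℝ) : ℂ) • ψ)
    {m : Type*} [Fintype m] [DecidableEq m] {Λm : Matrix m m ℂ} (hΛ : Λm.PosSemidef)
    (O : m → Matrix (Finset (Orb (FermionTorus d L))) (Finset (Orb (FermionTorus d L))) ℂ)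
    {κ' : Type*} (s : Finset κ')
    (Xc : κ' → Matrix (Finset (Orb (FermionTorus d L))) (Finset (Orb (FermionTorus d L))) ℂ)
    {ι : Type*} (tt : Finset ι)
    (Us Y : ι → Matrix (Finset (Orb (FermionTorus d L))) (Finset (Orb (FermionTorus d L))) ℂ)
    (hU : ∀ l ∈ tt, Us l * hubbardTorus d L t U = hubbardTorus d L t U * Us l)
    (hUK : ∀ l ∈ tt, ∀ ψ ∈ (szSector (2 * nh) 0 : Submodule ℂ (Fock (Orb (FermionTorus d L)))),
      Us l *ᵥ ψ ∈ (szSector (2 * nh) 0 : Submodule ℂ (Fock (Orb (FermionTorus d L)))))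
    (hUK' : ∀ l ∈ tt, ∀ ψ ∈ (szSector (2 * nh) 0 : Submodule ℂ (Fock (Orb (FermionTorus d L)))),
      (Us l)ᴴ *ᵥ ψ ∈ (szSector (2 * nh) 0 : Submodule ℂ (Fock (Orb (FermionTorus d L)))))
    (hUU : ∀ l ∈ tt, (Us l)ᴴ * Us l = 1)
    {ρ : Type*} (r : Finset ρ)
    (Q Z Z' : ρ → Matrix (Finset (Orb (FermionTorus d L))) (Finset (Orb (FermionTorus d L))) ℂ)
    (q : ρ → ℝ) (hQh : ∀ i ∈ r, (Q i).IsHermitian)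
    (hQ : ∀ i ∈ r, ∀ ψ ∈ (szSector (2 * nh) 0 : Submodule ℂ (Fock (Orb (FermionTorus d L)))),
      Q i *ᵥ ψ = ((q i : ℝ) : ℂ) • ψ)
    {γ : Type*} (u' : Finset γ)
    (C W : γ → Matrix (Finset (Orb (FermionTorus d L))) (Finset (Orb (FermionTorus d L))) ℂ)
    (hC : ∀ j ∈ u', C j * hubbardTorus d L t U = hubbardTorus d L t U * C j)
    (hCK : ∀ j ∈ u', ∀ ψ ∈ (szSector (2 * nh) 0 : Submodule ℂ (Fock (Orb (FermionTorus d L)))),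
      C j *ᵥ ψ ∈ (szSector (2 * nh) 0 : Submodule ℂ (Fock (Orb (FermionTorus d L)))))
    (hCK' : ∀ j ∈ u', ∀ ψ ∈ (szSector (2 * nh) 0 : Submodule ℂ (Fock (Orb (FermionTorus d L)))),
      (C j)ᴴ *ᵥ ψ ∈ (szSector (2 * nh) 0 : Submodule ℂ (Fock (Orb (FermionTorus d L)))))
    {δ : Type*} (ah : Finset δ) (dc : δ → ℝ)
    (V : δ → Matrix (Finset (Orb (FermionTorus d L))) (Finset (Orb (FermionTorus d L))) ℂ)
    {κ'' : Type*} (w : Finset κ'') (a : κ'' → ℂ)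
    (M : κ'' → Matrix (Finset (Orb (FermionTorus d L))) (Finset (Orb (FermionTorus d L))) ℂ)
    (hM : ∀ k ∈ w, (M k).IsContraction) {c : ℝ}
    (hcert : X - (c : ℂ) • (1 : Matrix (Finset (Orb (FermionTorus d L))) (Finset (Orb (FermionTorus d L))) ℂ) -
        ∑ i ∈ dens, ((μ i : ℝ) : ℂ) • (D i - ((ν i : ℝ) : ℂ) •
          (1 : Matrix (Finset (Orb (FermionTorus d L))) (Finset (Orb (FermionTorus d L))) ℂ)) -
        ((κ : ℝ) : ℂ) • (((u : ℝ) : ℂ) •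
          (1 : Matrix (Finset (Orb (FermionTorus d L))) (Finset (Orb (FermionTorus d L))) ℂ) - E) =
      gramForm Λm O +
        (∑ k ∈ s, (hubbardTorus d L t U * Xc k - Xc k * hubbardTorus d L t U) +
          ∑ l ∈ tt, (Us l * Y l * (Us l)ᴴ - Y l) +
          ∑ i ∈ r, (Z i * (Q i - ((q i : ℝ) : ℂ) • 1) + (Q i - ((q i : ℝ) : ℂ) • 1) * Z' i) +
          ∑ j ∈ u', (C j * W j - W j * C j)) +
        (∑ m' ∈ ah, ((dc m' : ℝ) : ℂ) • ((V m')ᴴ - V m') + ∑ k ∈ w, a k • M k)) :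
    c - ∑ k ∈ w, ‖a k‖ + ∑ i ∈ dens, μ i * (g i / (L : ℝ) ^ d - ν i) +
        κ * (u - groundEnergyAt (fermionTorusGraph d L) t U (2 * nh) / (L : ℝ) ^ d) ≤
      (((hubbardTorus d L t U).sectorGroundProj (szSector (2 * nh) 0)).projState X).re := by
  set A := hubbardTorus d L t U with hAdef
  set K : Submodule ℂ (Fock (Orb (FermionTorus d L))) := szSector (2 * nh) 0 with hKdef
  have hA : A.IsHermitian := hubbardTorus_isHermitian (hamiltonian_isHermitian_and_commute_holds _) t U
  have hKA : ∀ ψ ∈ K, A *ᵥ ψ ∈ K := fun ψ hψ => mulVec_hubbardTorus_mem_szSector t U hψ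
  have hK : K ≠ ⊥ := szSector_ne_bot t U hn
  -- the objective with the density constraints and the energy constraint folded in
  set X' := X - ∑ i ∈ dens, ((μ i : ℝ) : ℂ) • (D i - ((ν i : ℝ) : ℂ) •
      (1 : Matrix (Finset (Orb (FermionTorus d L))) (Finset (Orb (FermionTorus d L))) ℂ)) -
    ((κ : ℝ) : ℂ) • (((u : ℝ) : ℂ) •
      (1 : Matrix (Finset (Orb (FermionTorus d L))) (Finset (Orb (FermionTorus d L))) ℂ) - E) with hX'
  have hcert' : X' - (c : ℂ) • (1 : Matrix (Finset (Orb (FermionTorus d L))) (Finset (Orb (FermionTorus d L))) ℂ) =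
      gramForm Λm O +
        (∑ k ∈ s, (A * Xc k - Xc k * A) + ∑ l ∈ tt, (Us l * Y l * (Us l)ᴴ - Y l) +
          ∑ i ∈ r, (Z i * (Q i - ((q i : ℝ) : ℂ) • 1) + (Q i - ((q i : ℝ) : ℂ) • 1) * Z' i) +
          ∑ j ∈ u', (C j * W j - W j * C j)) +
        (∑ m' ∈ ah, ((dc m' : ℝ) : ℂ) • ((V m')ᴴ - V m') + ∑ k ∈ w, a k • M k) := by
    rw [hX', sub_right_comm _ _ ((c : ℂ) • (1 : Matrix _ _ ℂ)), sub_right_comm _ _ ((c : ℂ) • (1 : Matrix _ _ ℂ))]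
    exact hcert
  have h := Matrix.re_projState_ge_of_local_certificate hA K hKA hK X' hΛ O s Xc tt Us Y hU hUK hUK'
    hUU r Q Z Z' q hQh hQ u' C W hC hCK hCK' ah dc V w a M hM hcert'
  -- evaluation of the constraint observables and of the local energy in the tracial state
  set P := A.sectorGroundProj K with hP
  have hPh : P.IsHermitian := sectorGroundProj_isHermitian A K
  have hP2 : P * P = P := sectorGroundProj_mul_self A K
  have hP0 : P ≠ 0 := sectorGroundProj_ne_zero hA K hKA hK
  have hPA : P * A = ((A.minEnergyOn K : ℝ) : ℂ) • P := sectorGroundProj_mul hA K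
  set ω := P.projState with hω
  have hone : ω 1 = 1 := projState_one hPh hP2 hP0
  have hPT : ∀ v : TorusSite d L, P * (fockTranslate v).val = (fockTranslate v).val * P := fun v =>
    sectorGroundProj_commute hA K (fockTranslate_mul_hubbardTorus v t U)
      (fun ψ hψ => fockTranslate_mulVec_mem_szSector v hψ)
      (fun ψ hψ => fockTranslate_conjTranspose_mulVec_mem_szSector v hψ)
  have hTT : ∀ v : TorusSite d L, (fockTranslate v).valᴴ * (fockTranslate v).val = 1 :=
    fockTranslate_conjTranspose_mul_self
  have hωE : ω E = ((A.minEnergyOn K : ℝ) : ℂ) / (Fintype.card (TorusSite d L) : ℂ) :=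
    projState_eq_div_of_sum_conj hPh hP2 hP0 hPA (fun v => (fockTranslate v).val) hPT hTT hE
  have hωD : ∀ i ∈ dens, ω (D i) = ((g i : ℝ) : ℂ) / (Fintype.card (TorusSite d L) : ℂ) := by
    intro i hi
    have hPG : P * G i = ((g i : ℝ) : ℂ) • P := by
      have h0 := sectorGroundProj_mul_sub_smul A K (hGh i hi) (hG i hi)
      rw [Matrix.mul_sub, Matrix.mul_smul, Matrix.mul_one, sub_eq_zero] at h0
      exact h0
    exact projState_eq_div_of_sum_conj hPh hP2 hP0 hPG (fun v => (fockTranslate v).val) hPT hTT (hD i hi)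
  have hωX' : ω X' = ω X -
      ∑ i ∈ dens, ((μ i : ℝ) : ℂ) * (((g i : ℝ) : ℂ) / (Fintype.card (TorusSite d L) : ℂ) - ((ν i : ℝ) : ℂ)) -
      ((κ : ℝ) : ℂ) * (((u : ℝ) : ℂ) - ((A.minEnergyOn K : ℝ) : ℂ) / (Fintype.card (TorusSite d L) : ℂ)) := by
    rw [hX', map_sub, map_sub, map_sum, map_smul, map_sub, map_smul, hone, hωE, smul_eq_mul, smul_eq_mul,
      mul_one]
    congr 2
    refine Finset.sum_congr rfl fun i hi => ?_
    rw [map_smul, map_sub, map_smul, hone, hωD i hi, smul_eq_mul, smul_eq_mul, mul_one]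
  have hre : (ω X').re = (ω X).re - ∑ i ∈ dens, μ i * (g i / (L : ℝ) ^ d - ν i) -
      κ * (u - A.minEnergyOn K / (L : ℝ) ^ d) := by
    rw [hωX', card_torusSite]
    have e : ∑ i ∈ dens, ((μ i : ℝ) : ℂ) * (((g i : ℝ) : ℂ) / ((L ^ d : ℕ) : ℂ) - ((ν i : ℝ) : ℂ)) +
        ((κ : ℝ) : ℂ) * (((u : ℝ) : ℂ) - ((A.minEnergyOn K : ℝ) : ℂ) / ((L ^ d : ℕ) : ℂ)) =
        ((∑ i ∈ dens, μ i * (g i / (L : ℝ) ^ d - ν i) + κ * (u - A.minEnergyOn K / (L : ℝ) ^ d) : ℝ) : ℂ) := by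
      push_cast
      rfl
    rw [sub_sub, e, Complex.sub_re, Complex.ofReal_re, ← sub_sub]
  rw [hre] at h
  have hE : A.minEnergyOn K = groundEnergyAt (fermionTorusGraph d L) t U (2 * nh) :=
    (groundEnergyAt_eq_minEnergyOn_szSector (fermionTorusGraph d L) t U hn).symm
  rw [hE] at h
  linarith

/-- **With the energy hypothesis**: under the hypotheses of
`hubbardTorus_re_projState_ge_of_local_certificate_ineq`, if `κ ≥ 0` and the sector ground energy
per site satisfies `groundEnergyAt (fermionTorusGraph d L) t U (2n) / L^d ≤ u` (a certified upper
bound), then `c − Σₖ ‖aₖ‖ + Σᵢ μᵢ (gᵢ/L^d − νᵢ) ≤ Re ω_P(X)`: the ground state is feasible for the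
energy constraint, Wang et al. 2024 §III. [cite: WangEtAl2024, §III] -/
theorem hubbardTorus_re_projState_ge_of_local_certificate_ineq_of_energy_le (t U : ℝ) {nh : ℕ}
    (hn : nh ≤ Fintype.card (FermionTorus d L))
    (X E : Matrix (Finset (Orb (FermionTorus d L))) (Finset (Orb (FermionTorus d L))) ℂ)
    (hE : ∑ v : TorusSite d L, (fockTranslate v).val * E * (fockTranslate v).valᴴ =
      hubbardTorus d L t U) {κ u : ℝ} (hκ : 0 ≤ κ)
    (hu : groundEnergyAt (fermionTorusGraph d L) t U (2 * nh) / (L : ℝ) ^ d ≤ u)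
    {δ' : Type*} (dens : Finset δ') (μ ν g : δ' → ℝ)
    (D G : δ' → Matrix (Finset (Orb (FermionTorus d L))) (Finset (Orb (FermionTorus d L))) ℂ)
    (hD : ∀ i ∈ dens, ∑ v : TorusSite d L, (fockTranslate v).val * D i * (fockTranslate v).valᴴ = G i)
    (hGh : ∀ i ∈ dens, (G i).IsHermitian)
    (hG : ∀ i ∈ dens, ∀ ψ ∈ (szSector (2 * nh) 0 : Submodule ℂ (Fock (Orb (FermionTorus d L)))),
      G i *ᵥ ψ = ((g i : ℝ) : ℂ) • ψ)
    {m : Type*} [Fintype m] [DecidableEq m] {Λm : Matrix m m ℂ} (hΛ : Λm.PosSemidef)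
    (O : m → Matrix (Finset (Orb (FermionTorus d L))) (Finset (Orb (FermionTorus d L))) ℂ)
    {κ' : Type*} (s : Finset κ')
    (Xc : κ' → Matrix (Finset (Orb (FermionTorus d L))) (Finset (Orb (FermionTorus d L))) ℂ)
    {ι : Type*} (tt : Finset ι)
    (Us Y : ι → Matrix (Finset (Orb (FermionTorus d L))) (Finset (Orb (FermionTorus d L))) ℂ)
    (hU : ∀ l ∈ tt, Us l * hubbardTorus d L t U = hubbardTorus d L t U * Us l)
    (hUK : ∀ l ∈ tt, ∀ ψ ∈ (szSector (2 * nh) 0 : Submodule ℂ (Fock (Orb (FermionTorus d L)))),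
      Us l *ᵥ ψ ∈ (szSector (2 * nh) 0 : Submodule ℂ (Fock (Orb (FermionTorus d L)))))
    (hUK' : ∀ l ∈ tt, ∀ ψ ∈ (szSector (2 * nh) 0 : Submodule ℂ (Fock (Orb (FermionTorus d L)))),
      (Us l)ᴴ *ᵥ ψ ∈ (szSector (2 * nh) 0 : Submodule ℂ (Fock (Orb (FermionTorus d L)))))
    (hUU : ∀ l ∈ tt, (Us l)ᴴ * Us l = 1)
    {ρ : Type*} (r : Finset ρ)
    (Q Z Z' : ρ → Matrix (Finset (Orb (FermionTorus d L))) (Finset (Orb (FermionTorus d L))) ℂ)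
    (q : ρ → ℝ) (hQh : ∀ i ∈ r, (Q i).IsHermitian)
    (hQ : ∀ i ∈ r, ∀ ψ ∈ (szSector (2 * nh) 0 : Submodule ℂ (Fock (Orb (FermionTorus d L)))),
      Q i *ᵥ ψ = ((q i : ℝ) : ℂ) • ψ)
    {γ : Type*} (u' : Finset γ)
    (C W : γ → Matrix (Finset (Orb (FermionTorus d L))) (Finset (Orb (FermionTorus d L))) ℂ)
    (hC : ∀ j ∈ u', C j * hubbardTorus d L t U = hubbardTorus d L t U * C j)
    (hCK : ∀ j ∈ u', ∀ ψ ∈ (szSector (2 * nh) 0 : Submodule ℂ (Fock (Orb (FermionTorus d L)))),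
      C j *ᵥ ψ ∈ (szSector (2 * nh) 0 : Submodule ℂ (Fock (Orb (FermionTorus d L)))))
    (hCK' : ∀ j ∈ u', ∀ ψ ∈ (szSector (2 * nh) 0 : Submodule ℂ (Fock (Orb (FermionTorus d L)))),
      (C j)ᴴ *ᵥ ψ ∈ (szSector (2 * nh) 0 : Submodule ℂ (Fock (Orb (FermionTorus d L)))))
    {δ : Type*} (ah : Finset δ) (dc : δ → ℝ)
    (V : δ → Matrix (Finset (Orb (FermionTorus d L))) (Finset (Orb (FermionTorus d L))) ℂ)
    {κ'' : Type*} (w : Finset κ'') (a : κ'' → ℂ)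
    (M : κ'' → Matrix (Finset (Orb (FermionTorus d L))) (Finset (Orb (FermionTorus d L))) ℂ)
    (hM : ∀ k ∈ w, (M k).IsContraction) {c : ℝ}
    (hcert : X - (c : ℂ) • (1 : Matrix (Finset (Orb (FermionTorus d L))) (Finset (Orb (FermionTorus d L))) ℂ) -
        ∑ i ∈ dens, ((μ i : ℝ) : ℂ) • (D i - ((ν i : ℝ) : ℂ) •
          (1 : Matrix (Finset (Orb (FermionTorus d L))) (Finset (Orb (FermionTorus d L))) ℂ)) -
        ((κ : ℝ) : ℂ) • (((u : ℝ) : ℂ) •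
          (1 : Matrix (Finset (Orb (FermionTorus d L))) (Finset (Orb (FermionTorus d L))) ℂ) - E) =
      gramForm Λm O +
        (∑ k ∈ s, (hubbardTorus d L t U * Xc k - Xc k * hubbardTorus d L t U) +
          ∑ l ∈ tt, (Us l * Y l * (Us l)ᴴ - Y l) +
          ∑ i ∈ r, (Z i * (Q i - ((q i : ℝ) : ℂ) • 1) + (Q i - ((q i : ℝ) : ℂ) • 1) * Z' i) +
          ∑ j ∈ u', (C j * W j - W j * C j)) +
        (∑ m' ∈ ah, ((dc m' : ℝ) : ℂ) • ((V m')ᴴ - V m') + ∑ k ∈ w, a k • M k)) :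
    c - ∑ k ∈ w, ‖a k‖ + ∑ i ∈ dens, μ i * (g i / (L : ℝ) ^ d - ν i) ≤
      (((hubbardTorus d L t U).sectorGroundProj (szSector (2 * nh) 0)).projState X).re := by
  have h := hubbardTorus_re_projState_ge_of_local_certificate_ineq t U hn X E hE κ u dens μ ν g D G hD
    hGh hG hΛ O s Xc tt Us Y hU hUK hUK' hUU r Q Z Z' q hQh hQ u' C W hC hCK hCK' ah dc V w a M hM hcert
  have hslack : 0 ≤ κ * (u - groundEnergyAt (fermionTorusGraph d L) t U (2 * nh) / (L : ℝ) ^ d) :=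
    mul_nonneg hκ (sub_nonneg.2 hu)
  linarith

end Torus

/-! ### The window certificate with an energy constraint (square lattice, affine `D₄` reductions) -/

section Window

variable {L : ℕ} [NeZero L]

/-- (Local to this section, as in `HubbardWindowCertificateD4`.) [folklore] -/
local instance (priority := high) instDecidableEqFermionTorusCorr' : DecidableEq (FermionTorus 2 L) :=
  LinearOrder.toDecidableEq

/-- **Window certificate with an energy constraint and affine `D₄` reductions ⇒ ground-state
expectation of a local observable on every large square torus.** Data as in
`groundEnergyAt_div_ge_of_window_certificate_d4` (HubbardWindowCertificateD4): a window `Λ' ⊆ ℤ²`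
containing `[-1,1]²`, an inner region `Λ ⊆ Λ'` with all lattice neighbours in `Λ'`, and an identity
in the window algebra `𝔄_{Λ'}` for an arbitrary OBJECTIVE `X ∈ 𝔄_{Λ'}` with an energy-constraint
term (`E_Φ` the mean-energy observable of the Hubbard interaction, `κ, u` real):
`X − c·1 − Σ_σ μ_σ (n_{0σ} − ν·1) − κ (u·1 − Γ(incl) E_Φ) = Σ Λₐᵦ Oₐᴴ O_b + (Σₖ (H_{Λ'} Bₖ − Bₖ H_{Λ'})
   + Σₗ (Γ(incl)(Γ(d4Emb γₗ wₗ) Yₗ) − Γ(incl) Yₗ) + Σⱼ bⱼ • wⱼ) + (Σₘ dₘ • (Vₘᴴ − Vₘ) + Σₖ aₖ • vₖ)`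
(charged ladder words `wⱼ`, real `dₘ`, ladder words `vₖ`). Then for every `L ≥ 3` with
`x ↦ x mod L` injective on `thicken Λ' 1` and every `n ≤ L²`, in the tracial ground state `ω_P` of
the sector `(2n, S^z = 0)` of the torus `(ℤ/Lℤ)²`,
`c − Σₖ ‖aₖ‖ + (Σ_σ μ_σ)(n/L² − ν) + κ (u − groundEnergyAt (fermionTorusGraph 2 L) t U (2n)/L²)
   ≤ Re ω_P(Γ(ι_{Λ',L}) X)`.
Wang et al. 2024 §III (observable `O`, constraint `⟨E_up − H⟩ ≥ 0`) in Han's translation-invariant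
form with all square-lattice constraints (Han 2020 §3), read on the periodic box.
[cite: WangEtAl2024, §III] -/
theorem re_projState_ge_of_window_certificate_d4_ineq (t U : ℝ) (hL : 3 ≤ L) {nh : ℕ}
    (hn : nh ≤ Fintype.card (FermionTorus 2 L))
    {Λ Λ' : Finset (Site 2)} (hΛ : Λ ⊆ Λ')
    (hclosed : ∀ x ∈ Λ, ∀ i : Fin 2, x + unitVec i ∈ Λ' ∧ x - unitVec i ∈ Λ')
    (h0 : thicken ({0} : Finset (Site 2)) 1 ⊆ Λ') (hz : (0 : Site 2) ∈ Λ')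
    (hInj : Set.InjOn (Torus.proj (d := 2) L) ↑(thicken Λ' 1))
    (hInj' : Set.InjOn (Torus.proj (d := 2) L) ↑Λ')
    (Xw : FermionOp Λ') (κ u : ℝ) (μ : Fin 2 → ℝ) (ν : ℝ)
    {m : Type*} [Fintype m] [DecidableEq m] {Λm : Matrix m m ℂ} (hΛm : Λm.PosSemidef)
    (O : m → FermionOp Λ')
    {κ' : Type*} (s : Finset κ') (B : κ' → FermionOp Λ)
    {ι : Type*} (tt : Finset ι) (γ : ι → DihedralGroup 4) (wv : ι → Site 2)
    (hsh : ∀ l, d4ShiftSet (γ l) (wv l) Λ ⊆ Λ') (Y : ι → FermionOp Λ)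
    {ρ : Type*} (uu : Finset ρ) (b : ρ → ℂ) (cw : ρ → List (Orb (PolySite Λ') × Bool))
    (hcw : ∀ j ∈ uu, ladderCharge (cw j) ≠ 0 ∨ ladderSpinCharge (cw j) ≠ 0)
    {δ : Type*} (ah : Finset δ) (dc : δ → ℝ) (V : δ → FermionOp Λ')
    {κ'' : Type*} (w : Finset κ'') (a : κ'' → ℂ) (word : κ'' → List (Orb (PolySite Λ') × Bool)) {c : ℝ}
    (hcert : Xw - (c : ℂ) • (1 : FermionOp Λ') -
        ∑ σ : Fin 2, ((μ σ : ℝ) : ℂ) • (nAt 0 hz σ - ((ν : ℝ) : ℂ) • (1 : FermionOp Λ')) -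
        ((κ : ℝ) : ℂ) • (((u : ℝ) : ℂ) • (1 : FermionOp Λ') -
          fermionEmbed (PolySite.incl h0) ((hubbardFermionInteraction 2 t U).meanEnergyObs 1)) =
      gramForm Λm O +
        (∑ k ∈ s, ((hubbardFermionInteraction 2 t U).localHamiltonian Λ' * fermionEmbed (PolySite.incl hΛ) (B k) -
            fermionEmbed (PolySite.incl hΛ) (B k) * (hubbardFermionInteraction 2 t U).localHamiltonian Λ') +
          ∑ l ∈ tt, (fermionEmbed (PolySite.incl (hsh l)) (fermionEmbed (PolySite.d4Emb (γ l) (wv l) Λ) (Y l)) -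
            fermionEmbed (PolySite.incl hΛ) (Y l)) +
          ∑ j ∈ uu, b j • ladderWord (cw j)) +
        (∑ m' ∈ ah, ((dc m' : ℝ) : ℂ) • ((V m')ᴴ - V m') + ∑ k ∈ w, a k • ladderWord (word k))) :
    c - ∑ k ∈ w, ‖a k‖ + (∑ σ : Fin 2, μ σ) * ((nh : ℝ) / (L : ℝ) ^ 2 - ν) +
        κ * (u - groundEnergyAt (fermionTorusGraph 2 L) t U (2 * nh) / (L : ℝ) ^ 2) ≤
      (((hubbardTorus 2 L t U).sectorGroundProj (szSector (2 * nh) 0)).projState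
        (fermionEmbed (PolySite.toTorusEmb L hInj') Xw)).re := by
  have hInjΛ : Set.InjOn (Torus.proj (d := 2) L) ↑Λ := hInj'.mono (by exact_mod_cast hΛ)
  have hInj0 : Set.InjOn (Torus.proj (d := 2) L) ↑(thicken ({0} : Finset (Site 2)) 1) :=
    hInj'.mono (by exact_mod_cast h0)
  set Γ' := fermionEmbed (PolySite.toTorusEmb L hInj') with hΓ'
  set ΓΛ := fermionEmbed (PolySite.toTorusEmb L hInjΛ) with hΓΛ
  set H := hubbardTorus 2 L t U with hH
  set EΦ := (hubbardFermionInteraction 2 t U).meanEnergyObs 1 with hEΦ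
  set X := Γ' (fermionEmbed (PolySite.incl h0) EΦ) with hX
  have hX0 : X = fermionEmbed (PolySite.toTorusEmb L hInj0) EΦ := fermionEmbed_toTorusEmb_incl h0 hInj' EΦ
  have hsum : ∑ v' : TorusSite 2 L, (fockTranslate v').val * X * (fockTranslate v').valᴴ = H := by
    rw [hX0]
    have h := sum_relabel_translate_hubbard_meanEnergyObs (d := 2) t U hL
    simp_rw [relabel_eq_fockRelabel_conj] at h
    exact h
  set D : Fin 2 → Matrix (Finset (Orb (FermionTorus 2 L))) (Finset (Orb (FermionTorus 2 L))) ℂ :=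
    fun σ => numberOp (FermionTorus.ofTorusSite (0 : TorusSite 2 L)) σ with hD
  set G : Fin 2 → Matrix (Finset (Orb (FermionTorus 2 L))) (Finset (Orb (FermionTorus 2 L))) ℂ :=
    fun σ => ∑ y : FermionTorus 2 L, numberOp y σ with hG
  have hDΓ : ∀ σ, Γ' (nAt 0 hz σ) = D σ := fun σ => fermionEmbed_toTorusEmb_nAt_zero hz hInj' σ
  have hDsum : ∀ σ ∈ (Finset.univ : Finset (Fin 2)),
      ∑ v' : TorusSite 2 L, (fockTranslate v').val * D σ * (fockTranslate v').valᴴ = G σ :=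
    fun σ _ => sum_conj_fockTranslate_numberOp 0 σ
  have hGh : ∀ σ ∈ (Finset.univ : Finset (Fin 2)), (G σ).IsHermitian := fun σ _ => isHermitian_sum_numberOp σ
  have hGs : ∀ σ ∈ (Finset.univ : Finset (Fin 2)),
      ∀ ψ ∈ (szSector (2 * nh) 0 : Submodule ℂ (Fock (Orb (FermionTorus 2 L)))),
        G σ *ᵥ ψ = (((nh : ℝ) : ℝ) : ℂ) • ψ := by
    intro σ _ ψ hψ
    rw [hG, spinNumber_mulVec_of_mem_szSector σ hψ]
    congr 1
    push_cast
    ring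
  -- symmetry family: affine `D₄` maps
  set Us : ι → Matrix (Finset (Orb (FermionTorus 2 L))) (Finset (Orb (FermionTorus 2 L))) ℂ :=
    fun l => (fockTranslate (Torus.proj L (wv l))).val * (fockD4 (L := L) (γ l)).val with hUs
  set Yt : ι → Matrix (Finset (Orb (FermionTorus 2 L))) (Finset (Orb (FermionTorus 2 L))) ℂ :=
    fun l => ΓΛ (Y l) with hYt
  have hU : ∀ l ∈ tt, Us l * H = H * Us l := fun l _ => d4Affine_mul_hubbardTorus _ _ t U
  have hUK : ∀ l ∈ tt, ∀ ψ ∈ (szSector (2 * nh) 0 : Submodule ℂ (Fock (Orb (FermionTorus 2 L)))),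
      Us l *ᵥ ψ ∈ (szSector (2 * nh) 0 : Submodule ℂ (Fock (Orb (FermionTorus 2 L)))) :=
    fun l _ ψ hψ => d4Affine_mulVec_mem_szSector _ _ hψ
  have hUK' : ∀ l ∈ tt, ∀ ψ ∈ (szSector (2 * nh) 0 : Submodule ℂ (Fock (Orb (FermionTorus 2 L)))),
      (Us l)ᴴ *ᵥ ψ ∈ (szSector (2 * nh) 0 : Submodule ℂ (Fock (Orb (FermionTorus 2 L)))) :=
    fun l _ ψ hψ => d4Affine_conjTranspose_mulVec_mem_szSector _ _ hψ
  have hUU : ∀ l ∈ tt, (Us l)ᴴ * Us l = 1 := fun l _ => d4Affine_conjTranspose_mul_self _ _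
  -- charge family
  set emb : Orb (PolySite Λ') × Bool → Orb (FermionTorus 2 L) × Bool :=
    fun p => (Orb.embMap (PolySite.toTorusEmb L hInj') p.1, p.2) with hemb
  set C : ρ → Matrix (Finset (Orb (FermionTorus 2 L))) (Finset (Orb (FermionTorus 2 L))) ℂ :=
    fun j => if ladderCharge ((cw j).map emb) ≠ 0 then totalNumber else HubbardWave0.spinZ with hC
  set W : ρ → Matrix (Finset (Orb (FermionTorus 2 L))) (Finset (Orb (FermionTorus 2 L))) ℂ :=
    fun j => (b j / (if ladderCharge ((cw j).map emb) ≠ 0 then ((ladderCharge ((cw j).map emb) : ℤ) : ℂ)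
      else ((ladderSpinCharge ((cw j).map emb) : ℤ) : ℂ) / 2)) • ladderWord ((cw j).map emb) with hW
  have hHc := hamiltonian_isHermitian_and_commute_holds (fermionTorusGraph 2 L) t U
  have hC1 : ∀ j ∈ uu, C j * H = H * C j := by
    intro j _
    by_cases hq : ladderCharge ((cw j).map emb) ≠ 0
    · simp only [hC, hq, ne_eq, not_false_eq_true, if_true]; exact hHc.2.1.symm.eq
    · simp only [hC, hq, if_false]; exact hHc.2.2.symm.eq
  have hCK : ∀ j ∈ uu, ∀ ψ ∈ (szSector (2 * nh) 0 : Submodule ℂ (Fock (Orb (FermionTorus 2 L)))),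
      C j *ᵥ ψ ∈ (szSector (2 * nh) 0 : Submodule ℂ (Fock (Orb (FermionTorus 2 L)))) := by
    intro j _ ψ hψ
    obtain ⟨hNψ, hSψ⟩ := (mem_szSector_iff _ _ ψ).1 hψ
    by_cases hq : ladderCharge ((cw j).map emb) ≠ 0
    · simp only [hC, hq, ne_eq, not_false_eq_true, if_true]
      rw [totalNumber_mulVec_of_isNParticle hNψ]
      exact Submodule.smul_mem _ _ hψ
    · simp only [hC, hq, if_false]
      rw [hSψ]
      exact Submodule.smul_mem _ _ hψ
  have hCh : ∀ j, (C j)ᴴ = C j := by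
    intro j
    by_cases hq : ladderCharge ((cw j).map emb) ≠ 0
    · simp only [hC, hq, ne_eq, not_false_eq_true, if_true]
      rw [totalNumber_eq_numberDiag_univ]
      exact numberDiag_conjTranspose _
    · simp only [hC, hq, if_false]; exact HubbardWave0.spinZ_isHermitian.eq
  have hCK' : ∀ j ∈ uu, ∀ ψ ∈ (szSector (2 * nh) 0 : Submodule ℂ (Fock (Orb (FermionTorus 2 L)))),
      (C j)ᴴ *ᵥ ψ ∈ (szSector (2 * nh) 0 : Submodule ℂ (Fock (Orb (FermionTorus 2 L)))) :=
    fun j hj ψ hψ => by rw [hCh j]; exact hCK j hj ψ hψ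
  have hcharged : ∀ j ∈ uu, Γ' (b j • ladderWord (cw j)) = C j * W j - W j * C j := by
    intro j hj
    rw [map_smul, hΓ', fermionEmbed_ladderWord]
    have hl : ladderCharge ((cw j).map emb) ≠ 0 ∨ ladderSpinCharge ((cw j).map emb) ≠ 0 := by
      rw [hemb, ladderCharge_map_embMap, ladderSpinCharge_map_embMap]; exact hcw j hj
    exact smul_ladderWord_eq_commutator_of_charged (b j) _ hl
  -- residual words
  set M : κ'' → Matrix (Finset (Orb (FermionTorus 2 L))) (Finset (Orb (FermionTorus 2 L))) ℂ :=
    fun k => ladderWord ((word k).map emb) with hM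
  have hMc : ∀ k ∈ w, (M k).IsContraction := fun k _ => by
    rw [hM]; dsimp only; rw [ladderWord_eq_prod]; exact isContraction_prod_ladder _
  -- the left-hand side, pulled back into the torus
  have hlhs : Γ' (Xw - (c : ℂ) • (1 : FermionOp Λ') -
        ∑ σ : Fin 2, ((μ σ : ℝ) : ℂ) • (nAt 0 hz σ - ((ν : ℝ) : ℂ) • (1 : FermionOp Λ')) -
        ((κ : ℝ) : ℂ) • (((u : ℝ) : ℂ) • (1 : FermionOp Λ') - fermionEmbed (PolySite.incl h0) EΦ)) =
      Γ' Xw - (c : ℂ) • (1 : Matrix (Finset (Orb (FermionTorus 2 L))) (Finset (Orb (FermionTorus 2 L))) ℂ) -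
        ∑ σ ∈ (Finset.univ : Finset (Fin 2)), ((μ σ : ℝ) : ℂ) • (D σ - ((ν : ℝ) : ℂ) •
          (1 : Matrix (Finset (Orb (FermionTorus 2 L))) (Finset (Orb (FermionTorus 2 L))) ℂ)) -
        ((κ : ℝ) : ℂ) • (((u : ℝ) : ℂ) •
          (1 : Matrix (Finset (Orb (FermionTorus 2 L))) (Finset (Orb (FermionTorus 2 L))) ℂ) - X) := by
    have hs : Γ' (∑ σ : Fin 2, ((μ σ : ℝ) : ℂ) • (nAt 0 hz σ - ((ν : ℝ) : ℂ) • (1 : FermionOp Λ'))) =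
        ∑ σ ∈ (Finset.univ : Finset (Fin 2)), ((μ σ : ℝ) : ℂ) • (D σ - ((ν : ℝ) : ℂ) •
          (1 : Matrix (Finset (Orb (FermionTorus 2 L))) (Finset (Orb (FermionTorus 2 L))) ℂ)) := by
      rw [map_sum]
      exact Finset.sum_congr rfl fun σ _ => by rw [map_smul, map_sub, map_smul, map_one, hDΓ]
    have hk : Γ' (((κ : ℝ) : ℂ) • (((u : ℝ) : ℂ) • (1 : FermionOp Λ') - fermionEmbed (PolySite.incl h0) EΦ)) =
        ((κ : ℝ) : ℂ) • (((u : ℝ) : ℂ) •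
          (1 : Matrix (Finset (Orb (FermionTorus 2 L))) (Finset (Orb (FermionTorus 2 L))) ℂ) - X) := by
      rw [map_smul, map_sub, map_smul, map_one, hX]
    rw [map_sub, hk, map_sub, hs, map_sub, map_smul, map_one]
  -- the identity, pulled back into the torus
  have htorus : Γ' Xw - (c : ℂ) • (1 : Matrix (Finset (Orb (FermionTorus 2 L))) (Finset (Orb (FermionTorus 2 L))) ℂ) -
      ∑ σ ∈ (Finset.univ : Finset (Fin 2)), ((μ σ : ℝ) : ℂ) • (D σ - ((ν : ℝ) : ℂ) •
        (1 : Matrix (Finset (Orb (FermionTorus 2 L))) (Finset (Orb (FermionTorus 2 L))) ℂ)) -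
      ((κ : ℝ) : ℂ) • (((u : ℝ) : ℂ) •
        (1 : Matrix (Finset (Orb (FermionTorus 2 L))) (Finset (Orb (FermionTorus 2 L))) ℂ) - X) =
      gramForm Λm (fun i => Γ' (O i)) +
        (∑ k ∈ s, (H * Γ' (fermionEmbed (PolySite.incl hΛ) (B k)) - Γ' (fermionEmbed (PolySite.incl hΛ) (B k)) * H) +
          ∑ l ∈ tt, (Us l * Yt l * (Us l)ᴴ - Yt l) +
          ∑ i ∈ (∅ : Finset (Fin 0)), ((0 : Matrix _ _ ℂ) * ((0 : Matrix _ _ ℂ) - (((0 : ℝ) : ℝ) : ℂ) • 1) +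
            ((0 : Matrix _ _ ℂ) - (((0 : ℝ) : ℝ) : ℂ) • 1) * (0 : Matrix _ _ ℂ)) +
          ∑ j ∈ uu, (C j * W j - W j * C j)) +
        (∑ m' ∈ ah, ((dc m' : ℝ) : ℂ) • ((Γ' (V m'))ᴴ - Γ' (V m')) + ∑ k ∈ w, a k • M k) := by
    have key := congrArg Γ' hcert
    rw [hlhs] at key
    have h1 : Γ' (∑ k ∈ s, ((hubbardFermionInteraction 2 t U).localHamiltonian Λ' * fermionEmbed (PolySite.incl hΛ) (B k) -
        fermionEmbed (PolySite.incl hΛ) (B k) * (hubbardFermionInteraction 2 t U).localHamiltonian Λ')) =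
        ∑ k ∈ s, (H * Γ' (fermionEmbed (PolySite.incl hΛ) (B k)) - Γ' (fermionEmbed (PolySite.incl hΛ) (B k)) * H) := by
      rw [map_sum]
      refine Finset.sum_congr rfl fun k _ => ?_
      rw [hH, hΓ', hubbardTorus_commutator_fermionEmbed L t U hΛ hclosed hInj (B k)]
    have h2 : Γ' (∑ l ∈ tt, (fermionEmbed (PolySite.incl (hsh l)) (fermionEmbed (PolySite.d4Emb (γ l) (wv l) Λ) (Y l)) -
        fermionEmbed (PolySite.incl hΛ) (Y l))) = ∑ l ∈ tt, (Us l * Yt l * (Us l)ᴴ - Yt l) := by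
      rw [map_sum]
      refine Finset.sum_congr rfl fun l _ => ?_
      rw [hUs, hYt, hΓΛ, hΓ']
      exact fermionEmbed_toTorusEmb_d4_sub hΛ (γ l) (wv l) (hsh l) hInj' (Y l)
    have h3 : Γ' (∑ j ∈ uu, b j • ladderWord (cw j)) = ∑ j ∈ uu, (C j * W j - W j * C j) := by
      rw [map_sum]
      exact Finset.sum_congr rfl hcharged
    have h4 : Γ' (∑ m' ∈ ah, ((dc m' : ℝ) : ℂ) • ((V m')ᴴ - V m')) =
        ∑ m' ∈ ah, ((dc m' : ℝ) : ℂ) • ((Γ' (V m'))ᴴ - Γ' (V m')) := by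
      rw [map_sum]
      refine Finset.sum_congr rfl fun m' _ => ?_
      rw [map_smul, map_sub, hΓ', fermionEmbed_conjTranspose]
    have h5 : Γ' (∑ k ∈ w, a k • ladderWord (word k)) = ∑ k ∈ w, a k • M k := by
      rw [map_sum]
      refine Finset.sum_congr rfl fun k _ => ?_
      rw [map_smul, hM, hΓ', fermionEmbed_ladderWord]
    rw [key, map_add, map_add, map_add, map_add, map_add, hΓ', fermionEmbed_gramForm, ← hΓ', h1, h2, h3, h4, h5,
      Finset.sum_empty, add_zero]
  have hmain := hubbardTorus_re_projState_ge_of_local_certificate_ineq t U hn (Γ' Xw) X hsum κ u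
    (Finset.univ : Finset (Fin 2)) μ (fun _ => ν) (fun _ => (nh : ℝ)) D G hDsum hGh hGs hΛm
    (fun i => Γ' (O i)) s (fun k => Γ' (fermionEmbed (PolySite.incl hΛ) (B k))) tt Us Yt hU hUK hUK' hUU
    (∅ : Finset (Fin 0)) (fun _ => 0) (fun _ => 0) (fun _ => 0) (fun _ => 0)
    (fun i hi => absurd hi (Finset.notMem_empty i)) (fun i hi => absurd hi (Finset.notMem_empty i))
    uu C W hC1 hCK hCK' ah dc (fun m' => Γ' (V m')) w a M hMc htorus
  have hs : ∑ σ ∈ (Finset.univ : Finset (Fin 2)), μ σ * ((nh : ℝ) / (L : ℝ) ^ 2 - ν) =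
      (∑ σ : Fin 2, μ σ) * ((nh : ℝ) / (L : ℝ) ^ 2 - ν) := by rw [Finset.sum_mul]
  rw [hs] at hmain
  exact hmain

end Window

/-! ### Half filling on the even square torus: the bound holds for THE ground state -/

section HalfFilling

variable {d L : ℕ} [NeZero L]

/-- (Local to this section.) [folklore] -/
local instance (priority := high) instDecidableEqFermionTorusCorr'' : DecidableEq (FermionTorus d L) :=
  LinearOrder.toDecidableEq

/-- A translation unitary preserves the norm: `⟨U_v φ, U_v φ⟩ = ⟨φ, φ⟩`. [folklore] -/
theorem star_dotProduct_fockTranslate_mulVec (v : TorusSite d L) (φ : Fock (Orb (FermionTorus d L))) :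
    star ((fockTranslate v).val *ᵥ φ) ⬝ᵥ ((fockTranslate v).val *ᵥ φ) = star φ ⬝ᵥ φ := by
  rw [star_mulVec, dotProduct_mulVec, vecMul_vecMul, fockTranslate_conjTranspose_mul_self, vecMul_one]

/-- **Translates of ground states are ground states**: `U_v` commutes with the torus Hamiltonian
and preserves the particle number, so `U_v φ` is an `N`-particle ground state whenever `φ` is.
[cite: BratteliRobinsonII1997, §6.2.4] -/
theorem isGroundState_fockTranslate_mulVec (t U : ℝ) (v : TorusSite d L) {N : ℕ}
    {φ : Fock (Orb (FermionTorus d L))} (hφ : IsGroundState (hamiltonian (fermionTorusGraph d L) t U) N φ) :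
    IsGroundState (hamiltonian (fermionTorusGraph d L) t U) N ((fockTranslate v).val *ᵥ φ) := by
  obtain ⟨hN, hφ0, hHφ⟩ := hφ
  refine ⟨hN.fockRelabel_mulVec (Orb.translate v), ?_, ?_⟩
  · intro h0
    apply hφ0
    have h := congrArg (fun ψ => (fockTranslate v).valᴴ *ᵥ ψ) h0
    simp only [mulVec_mulVec, fockTranslate_conjTranspose_mul_self, one_mulVec, mulVec_zero] at h
    exact h
  · have hc : hamiltonian (fermionTorusGraph d L) t U * (fockTranslate v).val =
        (fockTranslate v).val * hamiltonian (fermionTorusGraph d L) t U :=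
      (fockTranslate_mul_hubbardTorus v t U).symm
    rw [mulVec_mulVec, hc, ← mulVec_mulVec, hHφ, mulVec_smul]

/-- **At half filling on the even square torus the tracial central-sector ground state is THE
ground state** (Lieb 1989, Theorem 2): for even `L`, `t ≠ 0`, `U > 0` and every normalised
`L²`-particle ground state `φ` of `hamiltonian (fermionTorusGraph 2 L) t U`,
`⟨φ, O φ⟩ = ω_P(O)` with `P` the ground projection of the sector `(L², S^z = 0)` (for any decidability
instance used to form `P`). [cite: LiebPRL1989, Theorem 2] -/
theorem LiebHalfFilled.hubbardTorus_groundState_expect_eq_projState {L : ℕ} [NeZero L] (hL : Even L)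
    {t U : ℝ} (ht : t ≠ 0) (hU : 0 < U)
    {instD : DecidableEq (Finset (Orb (FermionTorus 2 L)))}
    {φ : Fock (Orb (FermionTorus 2 L))} (hφ : IsGroundState (hamiltonian (fermionTorusGraph 2 L) t U) (L ^ 2) φ)
    (hφ1 : star φ ⬝ᵥ φ = 1) (O : Matrix (Finset (Orb (FermionTorus 2 L))) (Finset (Orb (FermionTorus 2 L))) ℂ) :
    star φ ⬝ᵥ O *ᵥ φ =
      (@Matrix.sectorGroundProj _ _ instD (hubbardTorus 2 L t U) (szSector (L ^ 2) 0)).projState O := by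
  show _ = (@Matrix.sectorGroundProj _ _ instD (hamiltonian (fermionTorusGraph 2 L) t U) (szSector (L ^ 2) 0)).projState O
  obtain ⟨ψ, -, hψ1, -, -, huniq, hstate⟩ := LiebHalfFilled.hubbardTorus_exists_unit_groundState (L := L) hL ht hU
  have hPeq := LiebHalfFilled.hubbardTorus_sectorGroundProj_szSector_eq (L := L) hL ht hU
  obtain ⟨hN, -, hHφ⟩ := hφ
  have hφeq : φ = (star ψ ⬝ᵥ φ) • ψ := huniq φ hN hHφ
  set cφ : ℂ := star ψ ⬝ᵥ φ with hcφ
  have hcc : star cφ * cφ = 1 := by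
    have h := hφ1
    rw [hφeq, star_smul, smul_dotProduct, dotProduct_smul, hψ1, smul_eq_mul, smul_eq_mul, mul_one] at h
    exact h
  have hval : star φ ⬝ᵥ O *ᵥ φ = star ψ ⬝ᵥ O *ᵥ ψ := by
    rw [hφeq, star_smul, mulVec_smul, smul_dotProduct, dotProduct_smul, smul_eq_mul, smul_eq_mul,
      ← mul_assoc, hcc, one_mul]
  rw [hval, ← hstate O, ← hPeq]
  congr!

/-- `2n = L²` ⇒ `n / L² = 1/2` (real form). [folklore] -/
private theorem half_of_two_mul_eq_sq {L nh : ℕ} [NeZero L] (hnh : 2 * nh = L ^ 2) :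
    (nh : ℝ) / (L : ℝ) ^ 2 = 1 / 2 := by
  have hL : (0 : ℝ) < (L : ℝ) ^ 2 := by
    have : (0 : ℝ) < L := by exact_mod_cast Nat.pos_of_ne_zero (NeZero.ne L)
    positivity
  have h : (2 : ℝ) * nh = (L : ℝ) ^ 2 := by exact_mod_cast hnh
  rw [div_eq_iff hL.ne']
  linarith

/-- **Window certificate with an energy constraint ⇒ correlator of THE half-filled ground state of
every large even square torus.** Under the data of `re_projState_ge_of_window_certificate_d4_ineq`,
for even `L ≥ 3` with `x ↦ x mod L` injective on `thicken Λ' 1`, `t ≠ 0`, `U > 0`, and every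
normalised `L²`-particle ground state `φ` of the torus (unique by Lieb's theorem):
`c − Σₖ ‖aₖ‖ + (Σ_σ μ_σ)(1/2 − ν) + κ (u − groundEnergyAt (fermionTorusGraph 2 L) t U (L²)/L²)
   ≤ Re ⟨φ, Γ(ι_{Λ',L}) X φ⟩`.
With `κ ≥ 0` and a certified finite-torus energy bound `E₀(L²)/L² ≤ u` the slack is nonnegative
(Wang et al. 2024 §III); the thermodynamic-limit form is
`InfVolFermionState.IsTorusLimitOf.re_expect_ge_of_window_certificate_d4_ineq`.
[cite: WangEtAl2024, §III] -/
theorem groundState_re_expect_ge_of_window_certificate_d4_ineq {L : ℕ} [NeZero L] (hLe : Even L)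
    (hL : 3 ≤ L) {t U : ℝ} (ht : t ≠ 0) (hU : 0 < U)
    {Λ Λ' : Finset (Site 2)} (hΛ : Λ ⊆ Λ')
    (hclosed : ∀ x ∈ Λ, ∀ i : Fin 2, x + unitVec i ∈ Λ' ∧ x - unitVec i ∈ Λ')
    (h0 : thicken ({0} : Finset (Site 2)) 1 ⊆ Λ') (hz : (0 : Site 2) ∈ Λ')
    (hInj : Set.InjOn (Torus.proj (d := 2) L) ↑(thicken Λ' 1))
    (hInj' : Set.InjOn (Torus.proj (d := 2) L) ↑Λ')
    (Xw : FermionOp Λ') (κ u : ℝ) (μ : Fin 2 → ℝ) (ν : ℝ)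
    {m : Type*} [Fintype m] [DecidableEq m] {Λm : Matrix m m ℂ} (hΛm : Λm.PosSemidef)
    (O : m → FermionOp Λ')
    {κ' : Type*} (s : Finset κ') (B : κ' → FermionOp Λ)
    {ι : Type*} (tt : Finset ι) (γ : ι → DihedralGroup 4) (wv : ι → Site 2)
    (hsh : ∀ l, d4ShiftSet (γ l) (wv l) Λ ⊆ Λ') (Y : ι → FermionOp Λ)
    {ρ : Type*} (uu : Finset ρ) (b : ρ → ℂ) (cw : ρ → List (Orb (PolySite Λ') × Bool))
    (hcw : ∀ j ∈ uu, ladderCharge (cw j) ≠ 0 ∨ ladderSpinCharge (cw j) ≠ 0)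
    {δ : Type*} (ah : Finset δ) (dc : δ → ℝ) (V : δ → FermionOp Λ')
    {κ'' : Type*} (w : Finset κ'') (a : κ'' → ℂ) (word : κ'' → List (Orb (PolySite Λ') × Bool)) {c : ℝ}
    (hcert : Xw - (c : ℂ) • (1 : FermionOp Λ') -
        ∑ σ : Fin 2, ((μ σ : ℝ) : ℂ) • (nAt 0 hz σ - ((ν : ℝ) : ℂ) • (1 : FermionOp Λ')) -
        ((κ : ℝ) : ℂ) • (((u : ℝ) : ℂ) • (1 : FermionOp Λ') -
          fermionEmbed (PolySite.incl h0) ((hubbardFermionInteraction 2 t U).meanEnergyObs 1)) =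
      gramForm Λm O +
        (∑ k ∈ s, ((hubbardFermionInteraction 2 t U).localHamiltonian Λ' * fermionEmbed (PolySite.incl hΛ) (B k) -
            fermionEmbed (PolySite.incl hΛ) (B k) * (hubbardFermionInteraction 2 t U).localHamiltonian Λ') +
          ∑ l ∈ tt, (fermionEmbed (PolySite.incl (hsh l)) (fermionEmbed (PolySite.d4Emb (γ l) (wv l) Λ) (Y l)) -
            fermionEmbed (PolySite.incl hΛ) (Y l)) +
          ∑ j ∈ uu, b j • ladderWord (cw j)) +
        (∑ m' ∈ ah, ((dc m' : ℝ) : ℂ) • ((V m')ᴴ - V m') + ∑ k ∈ w, a k • ladderWord (word k)))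
    {φ : Fock (Orb (FermionTorus 2 L))} (hφ : IsGroundState (hamiltonian (fermionTorusGraph 2 L) t U) (L ^ 2) φ)
    (hφ1 : star φ ⬝ᵥ φ = 1) :
    c - ∑ k ∈ w, ‖a k‖ + (∑ σ : Fin 2, μ σ) * (1 / 2 - ν) +
        κ * (u - groundEnergyAt (fermionTorusGraph 2 L) t U (L ^ 2) / (L : ℝ) ^ 2) ≤
      (star φ ⬝ᵥ fermionEmbed (PolySite.toTorusEmb L hInj') Xw *ᵥ φ).re := by
  -- the half-filled sector `2 nh = L²`
  obtain ⟨k, hk⟩ := hLe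
  set nh : ℕ := L ^ 2 / 2 with hnhdef
  have hnh : 2 * nh = L ^ 2 := by
    have h2 : L ^ 2 = 2 * (k * (k + k)) := by rw [hk]; ring
    rw [hnhdef, h2, Nat.mul_div_cancel_left _ two_pos]
  have hn : nh ≤ Fintype.card (FermionTorus 2 L) := by
    have hcard : Fintype.card (FermionTorus 2 L) = L ^ 2 := by simp [FermionTorus]
    rw [hcard]
    omega
  have h := re_projState_ge_of_window_certificate_d4_ineq t U hL hn hΛ hclosed h0 hz hInj hInj' Xw κ u μ ν
    hΛm O s B tt γ wv hsh Y uu b cw hcw ah dc V w a word hcert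
  rw [hnh, half_of_two_mul_eq_sq hnh,
    ← LiebHalfFilled.hubbardTorus_groundState_expect_eq_projState ⟨k, hk⟩ ht hU hφ hφ1] at h
  exact h

/-- **Translation-averaged form**: under the hypotheses of
`groundState_re_expect_ge_of_window_certificate_d4_ineq`, the translation-AVERAGED expectation
`torusAvgExpectAt L Λ' X φ = L⁻² Σ_v ⟨U_v φ, Γ(ι_{Λ',L}) X U_v φ⟩` (the quantity whose limits
define torus-limit states, `InfVolFermionState.IsTorusLimitOf`) obeys the same bound, since every
`U_v φ` is again a normalised ground state. [cite: WangEtAl2024, §III] -/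
theorem groundState_re_torusAvgExpectAt_ge_of_window_certificate_d4_ineq {L : ℕ} [NeZero L]
    (hLe : Even L) (hL : 3 ≤ L) {t U : ℝ} (ht : t ≠ 0) (hU : 0 < U)
    {Λ Λ' : Finset (Site 2)} (hΛ : Λ ⊆ Λ')
    (hclosed : ∀ x ∈ Λ, ∀ i : Fin 2, x + unitVec i ∈ Λ' ∧ x - unitVec i ∈ Λ')
    (h0 : thicken ({0} : Finset (Site 2)) 1 ⊆ Λ') (hz : (0 : Site 2) ∈ Λ')
    (hInj : Set.InjOn (Torus.proj (d := 2) L) ↑(thicken Λ' 1))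
    (Xw : FermionOp Λ') (κ u : ℝ) (μ : Fin 2 → ℝ) (ν : ℝ)
    {m : Type*} [Fintype m] [DecidableEq m] {Λm : Matrix m m ℂ} (hΛm : Λm.PosSemidef)
    (O : m → FermionOp Λ')
    {κ' : Type*} (s : Finset κ') (B : κ' → FermionOp Λ)
    {ι : Type*} (tt : Finset ι) (γ : ι → DihedralGroup 4) (wv : ι → Site 2)
    (hsh : ∀ l, d4ShiftSet (γ l) (wv l) Λ ⊆ Λ') (Y : ι → FermionOp Λ)
    {ρ : Type*} (uu : Finset ρ) (b : ρ → ℂ) (cw : ρ → List (Orb (PolySite Λ') × Bool))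
    (hcw : ∀ j ∈ uu, ladderCharge (cw j) ≠ 0 ∨ ladderSpinCharge (cw j) ≠ 0)
    {δ : Type*} (ah : Finset δ) (dc : δ → ℝ) (V : δ → FermionOp Λ')
    {κ'' : Type*} (w : Finset κ'') (a : κ'' → ℂ) (word : κ'' → List (Orb (PolySite Λ') × Bool)) {c : ℝ}
    (hcert : Xw - (c : ℂ) • (1 : FermionOp Λ') -
        ∑ σ : Fin 2, ((μ σ : ℝ) : ℂ) • (nAt 0 hz σ - ((ν : ℝ) : ℂ) • (1 : FermionOp Λ')) -
        ((κ : ℝ) : ℂ) • (((u : ℝ) : ℂ) • (1 : FermionOp Λ') -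
          fermionEmbed (PolySite.incl h0) ((hubbardFermionInteraction 2 t U).meanEnergyObs 1)) =
      gramForm Λm O +
        (∑ k ∈ s, ((hubbardFermionInteraction 2 t U).localHamiltonian Λ' * fermionEmbed (PolySite.incl hΛ) (B k) -
            fermionEmbed (PolySite.incl hΛ) (B k) * (hubbardFermionInteraction 2 t U).localHamiltonian Λ') +
          ∑ l ∈ tt, (fermionEmbed (PolySite.incl (hsh l)) (fermionEmbed (PolySite.d4Emb (γ l) (wv l) Λ) (Y l)) -
            fermionEmbed (PolySite.incl hΛ) (Y l)) +
          ∑ j ∈ uu, b j • ladderWord (cw j)) +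
        (∑ m' ∈ ah, ((dc m' : ℝ) : ℂ) • ((V m')ᴴ - V m') + ∑ k ∈ w, a k • ladderWord (word k)))
    {φ : Fock (Orb (FermionTorus 2 L))} (hφ : IsGroundState (hamiltonian (fermionTorusGraph 2 L) t U) (L ^ 2) φ)
    (hφ1 : star φ ⬝ᵥ φ = 1) :
    c - ∑ k ∈ w, ‖a k‖ + (∑ σ : Fin 2, μ σ) * (1 / 2 - ν) +
        κ * (u - groundEnergyAt (fermionTorusGraph 2 L) t U (L ^ 2) / (L : ℝ) ^ 2) ≤
      (torusAvgExpectAt L Λ' Xw φ).re := by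
  have hInj' : Set.InjOn (Torus.proj (d := 2) L) ↑Λ' := hInj.mono (by exact_mod_cast subset_thicken Λ' 1)
  set bnd : ℝ := c - ∑ k ∈ w, ‖a k‖ + (∑ σ : Fin 2, μ σ) * (1 / 2 - ν) +
    κ * (u - groundEnergyAt (fermionTorusGraph 2 L) t U (L ^ 2) / (L : ℝ) ^ 2) with hbnd
  have hterm : ∀ v : TorusSite 2 L, bnd ≤
      (expect (fermionEmbed (PolySite.toTorusEmb L hInj') Xw) ((fockTranslate v).val *ᵥ φ)).re := fun v =>
    groundState_re_expect_ge_of_window_certificate_d4_ineq hLe hL ht hU hΛ hclosed h0 hz hInj hInj' Xw κ u μ ν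
      hΛm O s B tt γ wv hsh Y uu b cw hcw ah dc V w a word hcert (isGroundState_fockTranslate_mulVec t U v hφ)
      (by rw [star_dotProduct_fockTranslate_mulVec, hφ1])
  rw [torusAvgExpectAt_of_injOn L hInj' Xw φ, card_torusSite, ← Complex.ofReal_natCast,
    ← Complex.ofReal_inv, Complex.re_ofReal_mul, Complex.re_sum]
  have hLpos : (0 : ℝ) < ((L ^ 2 : ℕ) : ℝ) := by
    have : 0 < L := Nat.pos_of_ne_zero (NeZero.ne L)
    positivity
  have hsum : ((L ^ 2 : ℕ) : ℝ) * bnd ≤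
      ∑ v : TorusSite 2 L, (expect (fermionEmbed (PolySite.toTorusEmb L hInj') Xw) ((fockTranslate v).val *ᵥ φ)).re := by
    have h := Finset.card_nsmul_le_sum (Finset.univ : Finset (TorusSite 2 L)) _ bnd fun v _ => hterm v
    rw [Finset.card_univ, card_torusSite, nsmul_eq_mul] at h
    exact h
  rw [← inv_mul_le_iff₀ (inv_pos.2 hLpos), inv_inv]
  exact hsum

end HalfFilling

/-! ### The thermodynamic limit: torus-limit ground states of `ℤ²` -/

section Limit

open Filter _root_.Topology

/-- **Certified correlator bounds for infinite-volume ground states of the half-filled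
square-lattice Hubbard model.** Let `ω` be a torus-limit state (`InfVolFermionState.IsTorusLimitOf`)
of normalised half-filled ground states `ψ_L` (`N = L²`) of `hamiltonian (fermionTorusGraph 2 L) t U`
along even `L → ∞` (`t ≠ 0`, `U > 0`), and suppose the thermodynamic-limit energy density satisfies
the certified upper bound `energyDensity2D t U 1 ≤ u`. Then a window certificate with energy
constraint `(κ ≥ 0, u)` for the objective `X ∈ 𝔄_{Λ'}` (data of
`re_projState_ge_of_window_certificate_d4_ineq`) proves
`c − Σₖ ‖aₖ‖ + (Σ_σ μ_σ)(1/2 − ν) ≤ Re ω(X)`.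
This is the statement "`λ·ω(V) ≥ E_cert` for every (symmetrised) translation-invariant ground state"
of the bundle's correlator certificates (format `certsdp/1` §7), for the ground states of `ℤ²` that
arise as limits of torus ground states: Wang et al. 2024 §III (the ground state is feasible for the
energy constraint `⟨E_up − H⟩ ≥ 0`), Han 2020 §3. [cite: WangEtAl2024, §III] -/
theorem InfVolFermionState.IsTorusLimitOf.re_expect_ge_of_window_certificate_d4_ineq
    {t U : ℝ} (ht : t ≠ 0) (hU : 0 < U) {κ u : ℝ} (hκ : 0 ≤ κ)
    (hu : ThermodynamicLimit.energyDensity2D t U 1 ≤ u)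
    {Λ Λ' : Finset (Site 2)} (hΛ : Λ ⊆ Λ')
    (hclosed : ∀ x ∈ Λ, ∀ i : Fin 2, x + unitVec i ∈ Λ' ∧ x - unitVec i ∈ Λ')
    (h0 : thicken ({0} : Finset (Site 2)) 1 ⊆ Λ') (hz : (0 : Site 2) ∈ Λ')
    (Xw : FermionOp Λ') (μ : Fin 2 → ℝ) (ν : ℝ)
    {m : Type*} [Fintype m] [DecidableEq m] {Λm : Matrix m m ℂ} (hΛm : Λm.PosSemidef)
    (O : m → FermionOp Λ')
    {κ' : Type*} (s : Finset κ') (B : κ' → FermionOp Λ)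
    {ι : Type*} (tt : Finset ι) (γ : ι → DihedralGroup 4) (wv : ι → Site 2)
    (hsh : ∀ l, d4ShiftSet (γ l) (wv l) Λ ⊆ Λ') (Y : ι → FermionOp Λ)
    {ρ : Type*} (uu : Finset ρ) (b : ρ → ℂ) (cw : ρ → List (Orb (PolySite Λ') × Bool))
    (hcw : ∀ j ∈ uu, ladderCharge (cw j) ≠ 0 ∨ ladderSpinCharge (cw j) ≠ 0)
    {δ : Type*} (ah : Finset δ) (dc : δ → ℝ) (V : δ → FermionOp Λ')
    {κ'' : Type*} (w : Finset κ'') (a : κ'' → ℂ) (word : κ'' → List (Orb (PolySite Λ') × Bool)) {c : ℝ}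
    (hcert : Xw - (c : ℂ) • (1 : FermionOp Λ') -
        ∑ σ : Fin 2, ((μ σ : ℝ) : ℂ) • (nAt 0 hz σ - ((ν : ℝ) : ℂ) • (1 : FermionOp Λ')) -
        ((κ : ℝ) : ℂ) • (((u : ℝ) : ℂ) • (1 : FermionOp Λ') -
          fermionEmbed (PolySite.incl h0) ((hubbardFermionInteraction 2 t U).meanEnergyObs 1)) =
      gramForm Λm O +
        (∑ k ∈ s, ((hubbardFermionInteraction 2 t U).localHamiltonian Λ' * fermionEmbed (PolySite.incl hΛ) (B k) -
            fermionEmbed (PolySite.incl hΛ) (B k) * (hubbardFermionInteraction 2 t U).localHamiltonian Λ') +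
          ∑ l ∈ tt, (fermionEmbed (PolySite.incl (hsh l)) (fermionEmbed (PolySite.d4Emb (γ l) (wv l) Λ) (Y l)) -
            fermionEmbed (PolySite.incl hΛ) (Y l)) +
          ∑ j ∈ uu, b j • ladderWord (cw j)) +
        (∑ m' ∈ ah, ((dc m' : ℝ) : ℂ) • ((V m')ᴴ - V m') + ∑ k ∈ w, a k • ladderWord (word k)))
    {Ls : ℕ → ℕ} (hLs : Tendsto Ls atTop atTop) (hev : ∀ j, Even (Ls j))
    {ψ : ∀ L, Fock (Orb (FermionTorus 2 L))}
    (hψ : ∀ j, _root_.Literature.MathematicalPhysics.QuantumLattice.IsGroundState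
      (hamiltonian (fermionTorusGraph 2 (Ls j)) t U) (Ls j ^ 2) (ψ (Ls j)))
    (hψ1 : ∀ j, star (ψ (Ls j)) ⬝ᵥ ψ (Ls j) = 1)
    {ω : InfVolFermionState 2} (hω : ω.IsTorusLimitOf ψ Ls) :
    c - ∑ k ∈ w, ‖a k‖ + (∑ σ : Fin 2, μ σ) * (1 / 2 - ν) ≤ (ω.expect Λ' Xw).re := by
  -- the averaged torus expectations converge to `ω(X)`
  have hlim : Tendsto (fun j => (torusAvgExpect (Ls j) Λ' Xw (ψ (Ls j))).re) atTop
      (𝓝 (ω.expect Λ' Xw).re) :=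
    (Complex.continuous_re.tendsto _).comp (hω Λ' Xw)
  -- the energies per site converge to the thermodynamic-limit density
  have hE : Tendsto (fun j => groundEnergyAt (fermionTorusGraph 2 (Ls j)) t U (Ls j ^ 2) / ((Ls j : ℕ) : ℝ) ^ 2)
      atTop (𝓝 (ThermodynamicLimit.energyDensity2D t U 1)) := by
    have h := (ThermodynamicLimit.tendsto_energyDensity2D_torus t hU.le zero_le_one one_lt_two).comp hLs
    refine h.congr fun j => ?_
    simp only [Function.comp_apply, HartreeFock.rectN_one_of_even (hev j)]
  set b0 : ℝ := c - ∑ k ∈ w, ‖a k‖ + (∑ σ : Fin 2, μ σ) * (1 / 2 - ν) with hb0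
  have hbnd : Tendsto (fun j => b0 + κ * (u - groundEnergyAt (fermionTorusGraph 2 (Ls j)) t U (Ls j ^ 2) /
      ((Ls j : ℕ) : ℝ) ^ 2)) atTop (𝓝 (b0 + κ * (u - ThermodynamicLimit.energyDensity2D t U 1))) :=
    tendsto_const_nhds.add ((tendsto_const_nhds.sub hE).const_mul κ)
  -- the finite-torus inequality holds for all large `j`
  obtain ⟨L₀, hL₀⟩ := exists_forall_le_injOn_proj (thicken Λ' 1)
  have hev' : ∀ᶠ j in atTop, b0 + κ * (u - groundEnergyAt (fermionTorusGraph 2 (Ls j)) t U (Ls j ^ 2) /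
      ((Ls j : ℕ) : ℝ) ^ 2) ≤ (torusAvgExpect (Ls j) Λ' Xw (ψ (Ls j))).re := by
    filter_upwards [hLs.eventually (eventually_ge_atTop (max L₀ 3))] with j hj
    have hL3 : 3 ≤ Ls j := le_trans (le_max_right _ _) hj
    have hLL : L₀ ≤ Ls j := le_trans (le_max_left _ _) hj
    haveI : NeZero (Ls j) := ⟨by omega⟩
    rw [torusAvgExpect_eq]
    exact groundState_re_torusAvgExpectAt_ge_of_window_certificate_d4_ineq (hev j) hL3 ht hU hΛ hclosed h0 hz
      (hL₀ (Ls j) hLL) Xw κ u μ ν hΛm O s B tt γ wv hsh Y uu b cw hcw ah dc V w a word hcert (hψ j) (hψ1 j)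
  have hle := le_of_tendsto_of_tendsto hbnd hlim hev'
  have hslack : 0 ≤ κ * (u - ThermodynamicLimit.energyDensity2D t U 1) := mul_nonneg hκ (sub_nonneg.2 hu)
  linarith

/-- **Weakening the energy bound re-parametrises the certificate**: an identity with energy
constraint `(c, κ, u)` is an identity with energy constraint `(c − κ (u' − u), κ, u')` for every
`u'` (pure algebra: `(c − κ(u'−u))·1 + κ (u'·1 − E) = c·1 + κ (u·1 − E)`). With `κ ≥ 0` and `u' ≥ u`
the certified constant only decreases; this is how a certificate issued for one certified upper
bound `u` on the energy density is used with a weaker one `u'` (e.g. the tree's Hartree–Fock bound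
`HartreeFock.energyDensity2D_le_sdw`). [folklore] -/
theorem certificate_ineq_reparam {A : Type*} [Ring A] [Algebra ℂ A] (X S E R : A) (c κ u u' : ℝ)
    (h : X - ((c : ℝ) : ℂ) • (1 : A) - S - ((κ : ℝ) : ℂ) • (((u : ℝ) : ℂ) • (1 : A) - E) = R) :
    X - ((c - κ * (u' - u) : ℝ) : ℂ) • (1 : A) - S - ((κ : ℝ) : ℂ) • (((u' : ℝ) : ℂ) • (1 : A) - E) = R := by
  rw [← h]
  push_cast
  module

/-- **Torus-limit half-filled ground states exist** (so the class quantified over in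
`InfVolFermionState.IsTorusLimitOf.re_expect_ge_of_window_certificate_d4_ineq` is not empty): for
`t ≠ 0`, `U > 0` there are even sides `Ls → ∞`, normalised `L²`-particle ground states `ψ_L` of the
tori `(ℤ/Lℤ)²` (Lieb, `LiebHalfFilled.hubbardTorus_exists_unit_groundState`) and an infinite-volume
state `ω` of the lattice fermions on `ℤ²` which is their torus limit (weak-⋆ compactness,
`InfVolFermionState.exists_isTorusLimitOf_subseq`). [cite: BratteliRobinsonII1997, §6.2.4] -/
theorem LiebHalfFilled.exists_isTorusLimitOf_groundState {t U : ℝ} (ht : t ≠ 0) (hU : 0 < U) :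
    ∃ (Ls : ℕ → ℕ) (ψ : ∀ L, Fock (Orb (FermionTorus 2 L))) (ω : InfVolFermionState 2),
      Tendsto Ls atTop atTop ∧ (∀ j, Even (Ls j)) ∧
      (∀ j, IsGroundState (hamiltonian (fermionTorusGraph 2 (Ls j)) t U) (Ls j ^ 2) (ψ (Ls j))) ∧
      (∀ j, star (ψ (Ls j)) ⬝ᵥ ψ (Ls j) = 1) ∧ ω.IsTorusLimitOf ψ Ls := by
  classical
  -- a normalised half-filled ground state on every even torus
  have hex : ∀ L : ℕ, ∃ φ : Fock (Orb (FermionTorus 2 L)), (Even L ∧ L ≠ 0) →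
      IsGroundState (hamiltonian (fermionTorusGraph 2 L) t U) (L ^ 2) φ ∧ star φ ⬝ᵥ φ = 1 := by
    intro L
    by_cases h : Even L ∧ L ≠ 0
    · haveI : NeZero L := ⟨h.2⟩
      obtain ⟨φ, hφK, hφ1, hHφ, -, -, -⟩ :=
        LiebHalfFilled.hubbardTorus_exists_unit_groundState (L := L) h.1 ht hU
      have hN : IsNParticle (L ^ 2) φ := ((mem_szSector_iff _ _ φ).1 hφK).1
      have hφ0 : φ ≠ 0 := by
        intro h0
        rw [h0, star_zero, zero_dotProduct] at hφ1
        exact zero_ne_one hφ1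
      exact ⟨φ, fun _ => ⟨⟨hN, hφ0, hHφ⟩, hφ1⟩⟩
    · exact ⟨0, fun h' => absurd h' h⟩
  choose ψ hψ using hex
  set Ls₀ : ℕ → ℕ := fun j => 2 * (j + 1) with hLs₀
  have hLs₀t : Tendsto Ls₀ atTop atTop :=
    tendsto_atTop_atTop.2 fun b => ⟨b, fun j hj => by simp only [hLs₀]; omega⟩
  have hev : ∀ j, Even (Ls₀ j) ∧ Ls₀ j ≠ 0 := fun j =>
    ⟨by simp only [hLs₀]; exact even_two_mul _, by simp only [hLs₀]; omega⟩
  obtain ⟨φ, hφ, ω, hω⟩ :=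
    InfVolFermionState.exists_isTorusLimitOf_subseq ψ hLs₀t (fun j => (hψ _ (hev j)).2)
  exact ⟨Ls₀ ∘ φ, ψ, ω, hLs₀t.comp hφ.tendsto_atTop, fun j => (hev (φ j)).1,
    fun j => (hψ _ (hev (φ j))).1, fun j => (hψ _ (hev (φ j))).2, hω⟩

end Limit

/-! ### The certified double occupancy and the slope of `U ↦ e(t,U,n)` -/

section DoubleOccupancyBridge

open Filter _root_.Topology

variable {d L : ℕ} [NeZero L]

/-- (Local to this section.) [folklore] -/
local instance (priority := high) instDecidableEqFermionTorusCorr4 : DecidableEq (FermionTorus d L) :=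
  LinearOrder.toDecidableEq

/-- **The translates of the local double occupancy exhaust the total double occupancy**:
`Σ_v ⟨U_v ψ, n_{0↑} n_{0↓} U_v ψ⟩ = ⟨ψ, (Σ_y n_{y↑} n_{y↓}) ψ⟩` (`U_vᴴ n_{0σ} U_v = n_{-v,σ}`, then
reindex `v ↦ -v`; cf. `sum_expect_numberOp_fockTranslate`). Bratteli–Robinson II §6.2.2 (space
averages of local observables over the periodic box). [cite: BratteliRobinsonII1997, §6.2.2] -/
theorem sum_expect_docc_fockTranslate (ψ : Fock (Orb (FermionTorus d L))) :
    ∑ v : TorusSite d L, expect (numberOp (FermionTorus.ofTorusSite (0 : TorusSite d L)) 0 *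
        numberOp (FermionTorus.ofTorusSite (0 : TorusSite d L)) 1) ((fockTranslate v).val *ᵥ ψ) =
      expect (∑ y : FermionTorus d L, numberOp y 0 * numberOp y 1) ψ := by
  have hstep : ∀ v : TorusSite d L,
      expect (numberOp (FermionTorus.ofTorusSite (0 : TorusSite d L)) 0 *
          numberOp (FermionTorus.ofTorusSite (0 : TorusSite d L)) 1) ((fockTranslate v).val *ᵥ ψ) =
        expect (numberOp (FermionTorus.ofTorusSite (-v)) 0 * numberOp (FermionTorus.ofTorusSite (-v)) 1) ψ := by
    intro v
    rw [expect_fockRelabel_mulVec, ← Equiv.Perm.inv_def, ← Orb.translate_neg, relabel_mul,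
      relabel_translate_numberOp, relabel_translate_numberOp, zero_add]
  simp_rw [hstep]
  have hsum : ∀ φ : Fock (Orb (FermionTorus d L)),
      expect (∑ y : FermionTorus d L, numberOp y 0 * numberOp y 1) φ =
        ∑ y : FermionTorus d L, expect (numberOp y 0 * numberOp y 1) φ := by
    intro φ
    rw [expect, Matrix.sum_mulVec, dotProduct_sum]
    rfl
  rw [hsum]
  exact Fintype.sum_equiv ((Equiv.neg (TorusSite d L)).trans FermionTorus.equivTorusSite.symm) _ _
    fun v => rfl

/-- **The averaged local double occupancy of a torus vector is the total double occupancy per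
site**: `torusAvgExpect L {0} (n_{0↑} n_{0↓}) ψ = L^{-d} ⟨ψ, (Σ_y n_{y↑} n_{y↓}) ψ⟩` (as
`torusAvgExpect_nAt_add_nAt` for the density). [cite: BratteliRobinsonII1997, §6.2.2] -/
theorem torusAvgExpect_docc (ψ : Fock (Orb (FermionTorus d L))) :
    torusAvgExpect L ({0} : Finset (Site d))
        (nAt 0 (Finset.mem_singleton_self 0) 0 * nAt 0 (Finset.mem_singleton_self 0) 1) ψ =
      ((L : ℂ) ^ d)⁻¹ * expect (∑ y : FermionTorus d L, numberOp y 0 * numberOp y 1) ψ := by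
  have h := injOn_proj_singleton (d := d) L 0
  have hcard : Fintype.card (TorusSite d L) = L ^ d := by simp [ZMod.card, Fintype.card_fin]
  have hproj : Torus.proj L (0 : Site d) = 0 := by funext i; simp [Torus.proj]
  rw [torusAvgExpect_eq, torusAvgExpectAt_of_injOn L h, hcard, Nat.cast_pow]
  congr 1
  have hn : ∀ σ : Fin 2, fermionEmbed (PolySite.toTorusEmb L h) (nAt 0 (Finset.mem_singleton_self 0) σ) =
      numberOp (FermionTorus.ofTorusSite (0 : TorusSite d L)) σ := by
    intro σ
    rw [nAt, fermionEmbed_numberOp, PolySite.toTorusEmb_apply, PolySite.ofLex_coe_pt, hproj]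
  rw [map_mul, hn 0, hn 1, sum_expect_docc_fockTranslate]

/-- **The local double occupancy of a torus-limit ground state is a supergradient of the
thermodynamic energy density in `U`.** Two dimensions, `0 ≤ n < 2`, `U, U' ≥ 0`: if `ω` is a torus
limit along `Ls → ∞` of normalised ground states `ψ_L` of `hamiltonian (fermionTorusGraph 2 L) t U`
in the sectors `N = N_L(n)` (`ThermodynamicLimit.rectN`), then
`e(t,U',n) − e(t,U,n) ≤ (U' − U) · Re ω(n_{0↑} n_{0↓})`
(`DoubleOccupancy.energyDensity2D_sub_le_mul_of_tendsto` with `D∞` = the double occupancy of `ω`,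
`torusAvgExpect_docc`). Hence a certified interval for `ω(n_{0↑}n_{0↓})` (the correlator
certificates above) bounds the one-sided slopes of the concave function `U ↦ e(t,U,n)`, and
conversely certified energy brackets bound `ω(n_{0↑}n_{0↓})`
(`DoubleOccupancy.energyDensity2D_doubleOcc_mem_Icc_of_bounds`). [cite: KomaTasaki1994, §1] -/
theorem InfVolFermionState.IsTorusLimitOf.energyDensity2D_sub_le_mul_re_expect_docc
    {ω : InfVolFermionState 2} {ψ : ∀ L, Fock (Orb (FermionTorus 2 L))} {Ls : ℕ → ℕ}
    (h : ω.IsTorusLimitOf ψ Ls) (hLs : Tendsto Ls atTop atTop) (t : ℝ) {U U' : ℝ} (hU : 0 ≤ U)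
    (hU' : 0 ≤ U') {n : ℝ} (hn0 : 0 ≤ n) (hn2 : n < 2)
    (hψ : ∀ j, _root_.Literature.MathematicalPhysics.QuantumLattice.IsGroundState
      (hamiltonian (fermionTorusGraph 2 (Ls j)) t U) (ThermodynamicLimit.rectN n (Ls j)) (ψ (Ls j)))
    (h1 : ∀ j, star (ψ (Ls j)) ⬝ᵥ ψ (Ls j) = 1) :
    ThermodynamicLimit.energyDensity2D t U' n - ThermodynamicLimit.energyDensity2D t U n ≤
      (U' - U) * (ω.expect ({0} : Finset (Site 2))
        (nAt 0 (Finset.mem_singleton_self 0) 0 * nAt 0 (Finset.mem_singleton_self 0) 1)).re := by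
  set V : FermionOp ({0} : Finset (Site 2)) :=
    nAt 0 (Finset.mem_singleton_self 0) 0 * nAt 0 (Finset.mem_singleton_self 0) 1 with hV
  have hlim : Tendsto (fun j => (torusAvgExpect (Ls j) ({0} : Finset (Site 2)) V (ψ (Ls j))).re) atTop
      (𝓝 (ω.expect ({0} : Finset (Site 2)) V).re) :=
    (Complex.continuous_re.tendsto _).comp (h _ V)
  have hD : Tendsto (fun j => (_root_.Literature.MathematicalPhysics.QuantumLattice.expect
      (∑ x : FermionTorus 2 (Ls j), numberOp x 0 * numberOp x 1)
      (ψ (Ls j))).re / ((Ls j : ℕ) : ℝ) ^ 2) atTop (𝓝 (ω.expect ({0} : Finset (Site 2)) V).re) := by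
    refine hlim.congr' ?_
    filter_upwards [hLs.eventually_ge_atTop 1] with j hj
    haveI : NeZero (Ls j) := ⟨Nat.one_le_iff_ne_zero.1 hj⟩
    rw [hV, torusAvgExpect_docc, ← Complex.ofReal_natCast, ← Complex.ofReal_pow,
      ← Complex.ofReal_inv, Complex.re_ofReal_mul, inv_mul_eq_div]
  exact DoubleOccupancy.energyDensity2D_sub_le_mul_of_tendsto t hU hU' hn0 hn2 hLs
    (ψ := fun j => ψ (Ls j)) hψ h1 hD

/-- The half-filled, even-`L` form (the family of
`InfVolFermionState.IsTorusLimitOf.re_expect_ge_of_window_certificate_d4_ineq`):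
`e(t,U',1) − e(t,U,1) ≤ (U' − U) · Re ω(n_{0↑} n_{0↓})` for every `U' ≥ 0`. [cite: KomaTasaki1994, §1] -/
theorem InfVolFermionState.IsTorusLimitOf.energyDensity2D_sub_le_mul_re_expect_docc_halfFilled
    {ω : InfVolFermionState 2} {ψ : ∀ L, Fock (Orb (FermionTorus 2 L))} {Ls : ℕ → ℕ}
    (h : ω.IsTorusLimitOf ψ Ls) (hLs : Tendsto Ls atTop atTop) (hev : ∀ j, Even (Ls j)) (t : ℝ)
    {U U' : ℝ} (hU : 0 ≤ U) (hU' : 0 ≤ U')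
    (hψ : ∀ j, _root_.Literature.MathematicalPhysics.QuantumLattice.IsGroundState
      (hamiltonian (fermionTorusGraph 2 (Ls j)) t U) (Ls j ^ 2) (ψ (Ls j)))
    (h1 : ∀ j, star (ψ (Ls j)) ⬝ᵥ ψ (Ls j) = 1) :
    ThermodynamicLimit.energyDensity2D t U' 1 - ThermodynamicLimit.energyDensity2D t U 1 ≤
      (U' - U) * (ω.expect ({0} : Finset (Site 2))
        (nAt 0 (Finset.mem_singleton_self 0) 0 * nAt 0 (Finset.mem_singleton_self 0) 1)).re :=
  h.energyDensity2D_sub_le_mul_re_expect_docc hLs t hU hU' zero_le_one one_lt_two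
    (fun j => by rw [HartreeFock.rectN_one_of_even (hev j)]; exact hψ j) h1

end DoubleOccupancyBridge

/-! ### Each certified double-occupancy bound is a family of certified ENERGY upper bounds -/

section EnergyFromDocc

open Filter _root_.Topology

/-- **A certified docc ceiling at `U` bounds the energy density ABOVE `U` from above.** If every
torus-limit half-filled ground state `ω` at `(t, U)` (`t ≠ 0`, `U > 0`; the hypothesis package of
the bundle's square-lattice correlator rows, with the energy hypothesis `e(t,U,1) ≤ u`) satisfies
`Re ω(n_{0↑}n_{0↓}) ≤ hi`, and `e(t,U,1) ≤ u`, then for every `U' ≥ U`: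
`e(t,U',1) ≤ u + (U' − U)·hi` (supergradient inequality
`IsTorusLimitOf.energyDensity2D_sub_le_mul_re_expect_docc_halfFilled` for one such `ω`, which exists
by `LiebHalfFilled.exists_isTorusLimitOf_groundState`). [cite: KomaTasaki1994, §1] -/
theorem ThermodynamicLimit.energyDensity2D_le_of_forall_isTorusLimitOf_docc_le {t U : ℝ} (ht : t ≠ 0)
    (hU : 0 < U) {u hi : ℝ} (hu : ThermodynamicLimit.energyDensity2D t U 1 ≤ u)
    (hhi : ∀ (ω : InfVolFermionState 2) (Ls : ℕ → ℕ) (ψ : ∀ L, Fock (Orb (FermionTorus 2 L))),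
      Tendsto Ls atTop atTop → (∀ j, Even (Ls j)) →
      (∀ j, _root_.Literature.MathematicalPhysics.QuantumLattice.IsGroundState
        (hamiltonian (fermionTorusGraph 2 (Ls j)) t U) (Ls j ^ 2) (ψ (Ls j))) →
      (∀ j, star (ψ (Ls j)) ⬝ᵥ ψ (Ls j) = 1) → ω.IsTorusLimitOf ψ Ls →
      ThermodynamicLimit.energyDensity2D t U 1 ≤ u →
      (ω.expect ({0} : Finset (Site 2))
        (nAt 0 (Finset.mem_singleton_self 0) 0 * nAt 0 (Finset.mem_singleton_self 0) 1)).re ≤ hi)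
    {U' : ℝ} (hU' : U ≤ U') :
    ThermodynamicLimit.energyDensity2D t U' 1 ≤ u + (U' - U) * hi := by
  obtain ⟨Ls, ψ, ω, hLs, hev, hψ, h1, hω⟩ := LiebHalfFilled.exists_isTorusLimitOf_groundState ht hU
  have hD := hhi ω Ls ψ hLs hev hψ h1 hω hu
  have hb := hω.energyDensity2D_sub_le_mul_re_expect_docc_halfFilled hLs hev t hU.le (hU.le.trans hU')
    hψ h1
  nlinarith [mul_le_mul_of_nonneg_left hD (sub_nonneg.2 hU')]

/-- **A certified docc floor at `U` bounds the energy density BELOW `U` from above.** With the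
same hypothesis package, if every torus-limit half-filled ground state at `(t, U)` satisfies
`lo ≤ Re ω(n_{0↑}n_{0↓})` and `e(t,U,1) ≤ u`, then for every `0 ≤ U' ≤ U`:
`e(t,U',1) ≤ u − (U − U')·lo` (improving the monotonicity bound `e(t,U',1) ≤ e(t,U,1)` by the
certified slope). [cite: KomaTasaki1994, §1] -/
theorem ThermodynamicLimit.energyDensity2D_le_of_forall_isTorusLimitOf_le_docc {t U : ℝ} (ht : t ≠ 0)
    (hU : 0 < U) {u lo : ℝ} (hu : ThermodynamicLimit.energyDensity2D t U 1 ≤ u)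
    (hlo : ∀ (ω : InfVolFermionState 2) (Ls : ℕ → ℕ) (ψ : ∀ L, Fock (Orb (FermionTorus 2 L))),
      Tendsto Ls atTop atTop → (∀ j, Even (Ls j)) →
      (∀ j, _root_.Literature.MathematicalPhysics.QuantumLattice.IsGroundState
        (hamiltonian (fermionTorusGraph 2 (Ls j)) t U) (Ls j ^ 2) (ψ (Ls j))) →
      (∀ j, star (ψ (Ls j)) ⬝ᵥ ψ (Ls j) = 1) → ω.IsTorusLimitOf ψ Ls →
      ThermodynamicLimit.energyDensity2D t U 1 ≤ u →
      lo ≤ (ω.expect ({0} : Finset (Site 2))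
        (nAt 0 (Finset.mem_singleton_self 0) 0 * nAt 0 (Finset.mem_singleton_self 0) 1)).re)
    {U' : ℝ} (hU'0 : 0 ≤ U') (hU' : U' ≤ U) :
    ThermodynamicLimit.energyDensity2D t U' 1 ≤ u - (U - U') * lo := by
  obtain ⟨Ls, ψ, ω, hLs, hev, hψ, h1, hω⟩ := LiebHalfFilled.exists_isTorusLimitOf_groundState ht hU
  have hD := hlo ω Ls ψ hLs hev hψ h1 hω hu
  have hb := hω.energyDensity2D_sub_le_mul_re_expect_docc_halfFilled hLs hev t hU.le hU'0 hψ h1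
  nlinarith [mul_le_mul_of_nonneg_left hD (sub_nonneg.2 hU')]

end EnergyFromDocc

end Literature.MathematicalPhysics.QuantumLattice
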